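import Summits.QuantumFields.YangMills.Theorems.BalabanUVNodesN15PerCubeGreenAdjointTwoGridKnitDefect
import Summits.QuantumFields.YangMills.Theorems.BalabanUVNodesN15PerCubeGreenAdjointSummandRows
import Summits.QuantumFields.YangMills.Theorems.BalabanUVNodesN15PerCubeGreenAdjointGreen
import Summits.QuantumFields.YangMills.Theorems.BalabanUVNodesN15PerCubeGreenTwoGridKnitDefectSummand
import Summits.QuantumFields.YangMills.Theorems.BalabanUVNodesN15PerCubeGreenFineDictionary
import Summits.QuantumFields.YangMills.Theorems.BalabanUVNodesN15PerCubeGreenTwoGridSiteFits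
import HarnessLib

/-!
# N15 = NE2, road (c) — PROGRAMME (PC), (PC-E-K) ENTRY 2 «`G′(U)∇*_U` of [B9] (3.42) for the NAMED scalar covariant Green's functions, TWO GRIDS»: ★★★ THE TWO-GRID η-DEFECT OF
# `G′(U)∘D*_{U,ν}` THROUGH THE COVARIANT TRANSPORT — n15-c∕429 with Bałaban's summand and perturbations LIVE, the right factors `E := D*_{U,ν}`, `E_f := D*_{U′,ν}` (n15-c∕284), the right
# inverses := THE NAMED GREEN's FUNCTIONS `G′(U) = cGreen (cvT e U) a`, `G′(U′)`, and every one-grid row PRODUCED from the POINTWISE (3.35) letters in the cube gauges (dag-n15-c g37, n15-c∕430)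

Cell `pub-ymgap`, seat `pub-ymgap-dag-n15-c` (generation g37; R134 (a), s1; HUMAN RULING D-0062).  `bears_on: R4∕N15 · K3⁸ SpineGivenEndpointR13SepCoPHV (stmt-QuantumFields-27366)`;
filed `--kind proof --supports stmt-QuantumFields-27366 --as helper` — COUNT-NEUTRAL.  ONE theorem; 0 `def`, 0 `sorry`; bookkeeping over landed rows, NO new estimate.  Imports BY NAME
n15-c∕429 `…PerCubeGreenAdjointTwoGridKnitDefect` (★★★ `uN_idef_scAdj_rightInverse_tr`), n15-c∕430a `…PerCubeGreenAdjointSummandRows` (the adjoint far rows `= 0`, the fine summand's right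
locality), n15-c∕286 `…PerCubeGreenAdjointGreen` (through it n15-c∕284 `covD_symm_covShape`, `mulOp_comp_covD_symm`; n15-c∕285 `rowSum_fgradMat_tCoefA_inl∕inr_le_at`, `rowSum_smul_conj_sub_one_le_at`,
`rowSum_fgradMat_neg_conj_le_at`, `rowSum_neg_conj_shift_le_at`; n15-c∕265 `scP`, `scNV`, `scP_conj`, `hasMaj_scNV_cut_of_rows`; n15-c∕266 `covLapM_add_scP_eq_mulVecLin_claplA`, `isUnit_cvT`,
n15-c∕201b `claplA_mul_cGreen`), n15-c∕340 `…PerCubeGreenTwoGridKnitDefectSummand` (for its imports: n15-c∕265′ `scP'`, `scNV'`, `scP'_conj`, `hasMaj_scNV'_cut_of_rows`; dag-n15-w2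
`rowSum_tCoefA_inl∕inr_le_at`, `rowSum_tCoefC_le_at`, `uN_abs_coordMat_conj_sub_one_entry_le_op`, `uN_abs_coordMat_conj_sub_conj_entry_le_op`, `uN_gaugeTransformed_bond_unitary`), n15-c∕266′
`…PerCubeGreenFineDictionary` (`covLapM_add_scP'_eq_mulVecLin_claplA`), n15-c∕338b `…PerCubeGreenTwoGridSiteFits` (`abs_fgrad_scH'_sub_le`).  Nothing in the tree is modified; nothing restated.
Generator HOME `tools/g37/build_430.py`.

THE THEOREM `uN_idef_scAdjGreen_tr`.  n15-c∕429's statement with: the summand `P := scP … U`, `P′ := scP′ … U′` (so `Δ_{R_U} + P = Δ′_a(U)` and the right inverses ARE `mulVecLin (cGreen (cvT e U) a)`,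
`mulVecLin (cGreen (cvT e U′) a′)` — n15-c∕266∕266′ + `claplA_mul_cGreen`), the perturbations `N_V k := scNV … (u′_k∘σ) U k`, `N′_V k := scNV′ … u′_k U′ k`, the right factors `E := D*_{U,ν} =
covD η ((cvT e U)_ν(· − e_ν)ᵀ) (· − e_ν)`, `E_f := D*_{U′,ν}` with their Leibniz remainders `∇⁺_ν h_k` and covariant shapes `M_{W_k}EM_{W_kᵀ} = M_{R_k}∇⁻_ν + M_{B_k}` (n15-c∕284); the DISPLAYED
data are now the POINTWISE (3.35) letters `‖V_μ(z) − 1‖ ≤ ηp`, `‖V_μ(z) − V_μ(z − e_μ)‖ ≤ η²q` of the transformed bond variables (fine `V′ = u′_kU′u′_kᴴ` on `Qf k` ⊇ box ± e_μ; coarse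
`V = (u′_k∘σ)U(u′_k∘σ)ᴴ` on `Qc k` — the covariant fit of the PAIRING), the thresholds `|ι|κ√m√m·p ≤ r_V`, `|ι||J|(|ι|(κ√m√m·p)² + κ√m√m·q) ≤ r_V`, `|ι|κ√m√m·q ≤ r_V`,
`r_V(1+|J⊕J|) + a₀|ι|(|ι|σ_c²+2σ_c) + a₀|ι|(|ι|σ_f²+2σ_f) ≤ R₀`, and the PAIRING fits proper: the bump-smeared species fits (`o_C o_A o_g`), the cut base defect of the perturbations (`o_N`), the
transporters' fits of the right factors (`o_R o_R′ o_B`), `o_C + o_A + o_g + o_N + o_R + o_R′ + o_B ≤ o`.  PRODUCED (all by name): `hP hP′` (`scP_conj`∕′), the coefficient letters and their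
QUOTIENTS at both grids (dag-n15-w2 ∕ n15-c∕285 rows from the entry letters), the cut rows of `N_V, N′_V` (`hasMaj_scNV_cut_of_rows`∕′), the adjoint far rows and their defect (ZERO, n15-c∕430a),
the right factors' Leibniz rules ∕ remainders (`|∇⁺_νh_k| ≤ π∕L^m`) ∕ covariant shapes ∕ rows `r_R = 1 + r_V`, `r_{∇R} = r_B = r_V` at both grids (n15-c∕284∕285), the remainders' fit (n15-c∕338b
`abs_fgrad_scH'_sub_le`, letter `O₁ ≤ (64π² + π²|J|)(L^k)^{−1∕4}` absorbed into the constant), the summand's right locality (n15-c∕430a), the column letter `ρ = |ι|η′κ√m√m·p` (414), the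
right inverses (NAMED).  CONCLUSION: `𝔇_{T,T}(G′(U′)∘D*_{U′,ν}, G′(U)∘D*_{U,ν}) ≤ D·((L^k)^{−1∕4} + o + ((1+ρ)^{(d+1)(L^r−1)} − 1))·e^{−(δ∕16)|y−y′|_T}`.

HONEST FRAMING ∕ LIMITS.  Bookkeeping on MODEL carriers at model level (the SCALAR covariant Green's functions `G′(U)`, `G′(U′)` of the doubled-torus cover; site → site right factors
`D*_{U,ν} = (D_U)ᵀ∘ext_ν`, n15-c∕284); the displayed pointwise letters and fits are the paper's (3.35) hypotheses in the cube gauges plus the PAIRING of the two backgrounds, whose producers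
(the Reg335 holder + the staircase pairing, n15-c∕37x∕41x for entries 0∕1; the bump-SMEARED ∕ shifted ∕ quotient species fits are NEW for entry 2) are NOT here.  The SHAPE of [B9] Thm 3.14's
two-grid difference for the entry `G′(U)∇*_U` of (3.42), NOT the printed theorem; nothing of [B5]∕[B6]∕[B7]∕[B9] asserted.  NE2⁺ NOT PRINTED, NOT proved; N15 of record untouched (DISCHARGED
AS CONSUMED, p687738); K3⁸ OPEN; counts of record UNMOVED (typed 28∕28 · discharged 8∕27); one finite 𝕋⁴ at fixed ε per index — NOT infinite volume, NOT OS on ℝ⁴, NOT a mass gap, NOT Clay.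
[cite: Balaban1985BackgroundPropagators, Thm 3.14 pp.426–427 (difference template), Thm 3.1 (3.42) p.397 (entry `G′(U)∇*_U`: shape), (3.34)–(3.35) p.396, (3.50)–(3.53) p.400, (3.59)–(3.65)
pp.402–403, (3.87)–(3.90) pp.409–410; Balaban1984PropagatorsII, (2.91)–(2.93) p.239, (2.133)–(2.136) p.247; Balaban1985Averaging, (125) p.36; King1986, p.664]
-/

noncomputable section

open scoped BigOperators Matrix Matrix.Norms.L2Operator

namespace Summit.QuantumFields.YangMills.BalabanUVNodes.N15.Gluing

open Real
open Literature.MathematicalPhysics.QuantumFieldTheory.Balaban1983to89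
open Literature.MathematicalPhysics.QuantumFieldTheory.Balaban1983to89.B5Prop11Plancherel (Tor fine unitVec)
open Literature.MathematicalPhysics.QuantumFieldTheory.Balaban1983to89.B11SectG (BlockNorm HasMaj hasMaj_zero)
open Literature.MathematicalPhysics.QuantumFieldTheory.Balaban1983to89.T4EtaRateDefect (idef idef_zero)
open Literature.MathematicalPhysics.QuantumFieldTheory.Balaban1983to89.T4EtaRateCoeffDefect (pull)
open Literature.MathematicalPhysics.QuantumFieldTheory.Balaban1983to89.B6Prop26Gluing (mulOp mulOp_apply ind ind_nonneg)
open Literature.MathematicalPhysics.QuantumFieldTheory.Balaban1983to89.B6UnitTorusCarrier (unitTorusGeo unitTorusGeo_dist_nonneg)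
open Literature.MathematicalPhysics.QuantumFieldTheory.Balaban1983to89.B5SiteBridgeP12 (MP)
open Literature.MathematicalPhysics.QuantumFieldTheory.King1986 (aK aK_pos aK_le)
open Literature.MathematicalPhysics.QuantumFieldTheory.King1986.Torus (blockOf)
open Literature.Barriers.QuantumFields (traceForm)
open Summit.QuantumFields.YangMills.BalabanUVNodes.N15.BackgroundLayer (covLapM tCoefA tCoefC fgrad fgrad_apply bgrad fgradMat)
open Summit.QuantumFields.YangMills.BalabanUVNodes.N15.VectorPiece (kingPr)
open Summit.QuantumFields.YangMills.BalabanUVNodes.N15.MatrixSpecies (mmulOp coordMat basisConst basisConst_nonneg liftBlk liftMap liftEquiv liftEquiv_apply covD)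
open Summit.QuantumFields.YangMills.BalabanUVNodes.N15.TwoGrid (chiCube cubeBlocks)
open Summit.QuantumFields.YangMills.BalabanUVNodes.N15.CurvedSpecies (gaugePair rowSum_tCoefA_inl_le_at rowSum_tCoefA_inr_le_at rowSum_tCoefC_le_at uN_abs_coordMat_conj_sub_one_entry_le_op
  uN_abs_coordMat_conj_sub_conj_entry_le_op uN_coordMat_conj_orthogonal uN_gaugeTransformed_bond_unitary uN_siteGauge_transpose_eq coordMat_mulLeftRight_mul uN_siteGauge_orthogonal
  rowSum_fgradMat_tCoefA_inl_le_at rowSum_fgradMat_tCoefA_inr_le_at rowSum_smul_conj_sub_one_le_at rowSum_fgradMat_neg_conj_le_at rowSum_neg_conj_shift_le_at uN_conj_coordMat_eq)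
open Summit.QuantumFields.YangMills.BalabanUVNodes.N15.CovLandau (cgrad cGreen csavg claplA claplA_mul_cGreen)
open Summit.QuantumFields.YangMills.BalabanUVNodes.N15.CovAvg (kingSec ctauS blockOf_kingPr)

variable {d : ℕ}

/-! ## The two-grid η-defect of `G′(U)∘D*_{U,ν}` with Bałaban's summand, through the covariant transport -/

section Green

variable {L : ℕ} [NeZero L]

set_option maxHeartbeats 3200000 in
/-- ★★★ **THE TWO-GRID η-DEFECT OF `G′(U)∘D*_{U,ν}` FOR THE NAMED SCALAR COVARIANT GREEN's FUNCTIONS** (n15-c∕429 with Bałaban's summand and perturbations live, the right factors `D*_{U,ν}`,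
`D*_{U′,ν}`, the right inverses the named Green's functions, every one-grid row produced from the pointwise (3.35) letters; see the module docstring).  MODEL carriers; the SHAPE of
[B9] Thm 3.14 for the entry `G′(U)∇*_U` of (3.42), NOT the printed theorem.
[cite: Balaban1985BackgroundPropagators, Thm 3.14 pp.426–427 (difference template), Thm 3.1 (3.42) p.397 (entry `G′(U)∇*_U`: shape), (3.34)–(3.35) p.396, (3.50)–(3.53) p.400, (3.59)–(3.65) pp.402–403; Balaban1984PropagatorsII, (2.91)–(2.93) p.239, (2.133)–(2.136) p.247; King1986, p.664] -/
theorem uN_idef_scAdjGreen_tr (hL : Odd L ∧ 1 < L) (hL7 : 7 ≤ L) {a₀ : ℝ} (ha₀ : 0 < a₀) (ι : Type) [Fintype ι] [DecidableEq ι] (ν : Fin (d + 1)) :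
    ∃ δ w₀ R₀ D : ℝ, 0 < δ ∧ 0 < R₀ ∧ ∀ (mv kk r : ℕ), 1 ≤ kk → 1 ≤ r → w₀ ≤ ((L ^ mv : ℕ) : ℝ) →
      ∀ {m : Type} [Fintype m] [DecidableEq m] (e : Matrix m m ℂ ≃L[ℝ] (ι → ℝ)), (∀ A B : Matrix m m ℂ, traceForm A B = e A ⬝ᵥ e B) →
      ∀ (u' : (Fin (d + 1) → ZMod (2 * L)) → ScX' d L mv kk r hL → Matrix m m ℂ), (∀ k x', (u' k x')ᴴ * u' k x' = 1) →
      ∀ (U : Fin (d + 1) → ScX d L mv kk hL → Matrix m m ℂ), (∀ μ x, (U μ x)ᴴ * U μ x = 1) → ∀ (U' : Fin (d + 1) → ScX' d L mv kk r hL → Matrix m m ℂ), (∀ μ x', (U' μ x')ᴴ * U' μ x' = 1) →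
      ∀ (Qf : (Fin (d + 1) → ZMod (2 * L)) → Set (ScX' d L mv kk r hL)) (Qc : (Fin (d + 1) → ZMod (2 * L)) → Set (ScX d L mv kk hL)) (p q : ℝ), 0 ≤ p → 0 ≤ q →
        (∀ k x', scChi' d L mv kk r hL k x' ≠ 0 → x' ∈ Qf k ∧ (∀ μ, ((scShift' d L mv kk r hL) μ).symm x' ∈ Qf k) ∧ (∀ μ, (scShift' d L mv kk r hL) μ x' ∈ Qf k)) → (∀ k y', scBlk' d L mv kk r hL y' ∈ cvSk d L mv kk hL k → y' ∈ Qf k) →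
        (∀ k x, scChi d L mv kk hL k x ≠ 0 → x ∈ Qc k ∧ (∀ μ, ((scShift d L mv kk hL) μ).symm x ∈ Qc k) ∧ (∀ μ, (scShift d L mv kk hL) μ x ∈ Qc k)) →
        -- the POINTWISE (3.35) letters of the transformed bond variables: fine, in the cube gauge `u′_k`, on `Qf k`; coarse, in the INDUCED gauge `u′_k∘σ`, on `Qc k` (the covariant fit of the PAIRING, displayed)
        (∀ k μ z, z ∈ Qf k → ‖(u' k z * U' μ z * (u' k ((scShift' d L mv kk r hL) μ z))ᴴ) - 1‖ ≤ ((((L ^ r * L ^ kk : ℕ) : ℝ))⁻¹) * p) →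
        (∀ k μ z, z ∈ Qf k → ‖(u' k z * U' μ z * (u' k ((scShift' d L mv kk r hL) μ z))ᴴ) - (u' k (((scShift' d L mv kk r hL) μ).symm z) * U' μ (((scShift' d L mv kk r hL) μ).symm z) * (u' k ((scShift' d L mv kk r hL) μ (((scShift' d L mv kk r hL) μ).symm z)))ᴴ)‖ ≤ ((((L ^ r * L ^ kk : ℕ) : ℝ))⁻¹) ^ 2 * q) →
        (∀ k μ x, x ∈ Qc k → ‖(u' k (kingSec (cvM d L mv kk hL) L kk r x) * U μ x * (u' k (kingSec (cvM d L mv kk hL) L kk r ((scShift d L mv kk hL) μ x)))ᴴ) - 1‖ ≤ ((((L ^ kk : ℕ) : ℝ))⁻¹) * p) →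
        (∀ k μ x, x ∈ Qc k → ‖(u' k (kingSec (cvM d L mv kk hL) L kk r x) * U μ x * (u' k (kingSec (cvM d L mv kk hL) L kk r ((scShift d L mv kk hL) μ x)))ᴴ) - (u' k (kingSec (cvM d L mv kk hL) L kk r (((scShift d L mv kk hL) μ).symm x)) * U μ (((scShift d L mv kk hL) μ).symm x) * (u' k (kingSec (cvM d L mv kk hL) L kk r ((scShift d L mv kk hL) μ (((scShift d L mv kk hL) μ).symm x))))ᴴ)‖ ≤ ((((L ^ kk : ℕ) : ℝ))⁻¹) ^ 2 * q) →
      ∀ (rV oC oA og oN oR oR' oB o : ℝ), 0 ≤ rV → 0 ≤ oC → 0 ≤ oA → 0 ≤ og → 0 ≤ oN → 0 ≤ oR → 0 ≤ oR' → 0 ≤ oB →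
        Fintype.card ι * (@basisConst ι _ (Matrix m m ℂ) Matrix.frobeniusNormedAddCommGroup Matrix.frobeniusNormedSpace e * (2 * Real.sqrt (Fintype.card m)) * (Real.sqrt (Fintype.card m) * p)) ≤ rV → Fintype.card ι * (Fintype.card (Fin (d + 1)) * (Fintype.card ι * (@basisConst ι _ (Matrix m m ℂ) Matrix.frobeniusNormedAddCommGroup Matrix.frobeniusNormedSpace e * (2 * Real.sqrt (Fintype.card m)) * (Real.sqrt (Fintype.card m) * p)) ^ 2 + (@basisConst ι _ (Matrix m m ℂ) Matrix.frobeniusNormedAddCommGroup Matrix.frobeniusNormedSpace e * (2 * Real.sqrt (Fintype.card m)) * (Real.sqrt (Fintype.card m) * q)))) ≤ rV → Fintype.card ι * (@basisConst ι _ (Matrix m m ℂ) Matrix.frobeniusNormedAddCommGroup Matrix.frobeniusNormedSpace e * (2 * Real.sqrt (Fintype.card m)) * (Real.sqrt (Fintype.card m) * q)) ≤ rV →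
        rV * (1 + Fintype.card (Fin (d + 1) ⊕ Fin (d + 1))) + (a₀ * (Fintype.card ι * (Fintype.card ι * ((1 + rV * ((((L ^ kk : ℕ) : ℝ))⁻¹)) ^ ((d + 1) * L ^ kk) - 1) ^ 2 + 2 * ((1 + rV * ((((L ^ kk : ℕ) : ℝ))⁻¹)) ^ ((d + 1) * L ^ kk) - 1))) + a₀ * (Fintype.card ι * (Fintype.card ι * ((1 + rV * ((((L ^ r * L ^ kk : ℕ) : ℝ))⁻¹)) ^ ((d + 1) * (L ^ r * L ^ kk)) - 1) ^ 2 + 2 * ((1 + rV * ((((L ^ r * L ^ kk : ℕ) : ℝ))⁻¹)) ^ ((d + 1) * (L ^ r * L ^ kk)) - 1)))) ≤ R₀ → oC + oA + og + oN + oR + oR' + oB ≤ o →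
        -- the PAIRING data (displayed): the bump-smeared species fits across King's pairing (values, shifted first-order coefficients, their quotients), the cut base defect of the perturbations, the transporters' fits of the right factors
        (∀ k x' i, ∑ j, |(scBump' d L mv kk r hL k x' • (tCoefC ((((L ^ r * L ^ kk : ℕ) : ℝ))⁻¹) (gaugePair (scShift' d L mv kk r hL) fun μ x => coordMat e (ContinuousLinearMap.mulLeftRight ℝ (Matrix m m ℂ) (u' k x * U' μ x * (u' k ((scShift' d L mv kk r hL) μ x))ᴴ) (u' k x * U' μ x * (u' k ((scShift' d L mv kk r hL) μ x))ᴴ)ᴴ))) x') i j - (scBump d L mv kk hL k ((kingPr L kk r (cvM d L mv kk hL)) x') • (tCoefC ((((L ^ kk : ℕ) : ℝ))⁻¹) (gaugePair (scShift d L mv kk hL) fun μ x => coordMat e (ContinuousLinearMap.mulLeftRight ℝ (Matrix m m ℂ) (u' k ((kingSec (cvM d L mv kk hL) L kk r) x) * U μ x * (u' k ((kingSec (cvM d L mv kk hL) L kk r) ((scShift d L mv kk hL) μ x)))ᴴ) (u' k ((kingSec (cvM d L mv kk hL) L kk r) x) * U μ x * (u' k ((kingSec (cvM d L mv kk hL)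 L kk r) ((scShift d L mv kk hL) μ x)))ᴴ)ᴴ))) ((kingPr L kk r (cvM d L mv kk hL)) x')) i j| ≤ oC) →
        (∀ k j' x' i, ∑ j, |(scBump' d L mv kk r hL k x' • (tCoefA ((((L ^ r * L ^ kk : ℕ) : ℝ))⁻¹) (gaugePair (scShift' d L mv kk r hL) fun μ x => coordMat e (ContinuousLinearMap.mulLeftRight ℝ (Matrix m m ℂ) (u' k x * U' μ x * (u' k ((scShift' d L mv kk r hL) μ x))ᴴ) (u' k x * U' μ x * (u' k ((scShift' d L mv kk r hL) μ x))ᴴ)ᴴ))) j' x') i j - (scBump d L mv kk hL k ((kingPr L kk r (cvM d L mv kk hL)) x') • (tCoefA ((((L ^ kk : ℕ) : ℝ))⁻¹) (gaugePair (scShift d L mv kk hL) fun μ x => coordMat e (ContinuousLinearMap.mulLeftRight ℝ (Matrix m m ℂ) (u' k ((kingSec (cvM d L mv kk hL) L kk r) x) * U μ x * (u' k ((kingSec (cvM d L mv kk hL) L kk r) ((scShift d L mv kk hL) μ x)))ᴴ) (u' k ((kingSec (cvM d L mv kk hL) L kk r) x) * U μ x * (u' k ((kingSec (cvM d L mv kk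 hL) L kk r) ((scShift d L mv kk hL) μ x)))ᴴ)ᴴ))) j' ((kingPr L kk r (cvM d L mv kk hL)) x')) i j| ≤ oC) →
        (∀ k μ x' i, ∑ j, |(scBump' d L mv kk r hL k (((scShift' d L mv kk r hL) μ).symm x') • (tCoefA ((((L ^ r * L ^ kk : ℕ) : ℝ))⁻¹) (gaugePair (scShift' d L mv kk r hL) fun μ x => coordMat e (ContinuousLinearMap.mulLeftRight ℝ (Matrix m m ℂ) (u' k x * U' μ x * (u' k ((scShift' d L mv kk r hL) μ x))ᴴ) (u' k x * U' μ x * (u' k ((scShift' d L mv kk r hL) μ x))ᴴ)ᴴ))) (Sum.inl μ) (((scShift' d L mv kk r hL) μ).symm x')) i j - (scBump d L mv kk hL k (((scShift d L mv kk hL) μ).symm ((kingPr L kk r (cvM d L mv kk hL)) x')) • (tCoefA ((((L ^ kk : ℕ) : ℝ))⁻¹) (gaugePair (scShift d L mv kk hL) fun μ x => coordMat e (ContinuousLinearMap.mulLeftRight ℝ (Matrix m m ℂ) (u' k ((kingSec (cvM d L mv kk hL) L kk r) x) * U μ x * (u' k ((kingSec (cvM d L mv kk hL) L kk r) ((scShift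 d L mv kk hL) μ x)))ᴴ) (u' k ((kingSec (cvM d L mv kk hL) L kk r) x) * U μ x * (u' k ((kingSec (cvM d L mv kk hL) L kk r) ((scShift d L mv kk hL) μ x)))ᴴ)ᴴ))) (Sum.inl μ) (((scShift d L mv kk hL) μ).symm ((kingPr L kk r (cvM d L mv kk hL)) x'))) i j| ≤ oA) →
        (∀ k μ x' i, ∑ j, |(scBump' d L mv kk r hL k ((scShift' d L mv kk r hL) μ x') • (tCoefA ((((L ^ r * L ^ kk : ℕ) : ℝ))⁻¹) (gaugePair (scShift' d L mv kk r hL) fun μ x => coordMat e (ContinuousLinearMap.mulLeftRight ℝ (Matrix m m ℂ) (u' k x * U' μ x * (u' k ((scShift' d L mv kk r hL) μ x))ᴴ) (u' k x * U' μ x * (u' k ((scShift' d L mv kk r hL) μ x))ᴴ)ᴴ))) (Sum.inr μ) ((scShift' d L mv kk r hL) μ x')) i j - (scBump d L mv kk hL k ((scShift d L mv kk hL) μ ((kingPr L kk r (cvM d L mv kk hL)) x')) • (tCoefA ((((L ^ kk : ℕ) : ℝ))⁻¹) (gaugePair (scShift d L mv kk hL) fun μ x => coordMat e (ContinuousLinearMap.mulLeftRight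 ℝ (Matrix m m ℂ) (u' k ((kingSec (cvM d L mv kk hL) L kk r) x) * U μ x * (u' k ((kingSec (cvM d L mv kk hL) L kk r) ((scShift d L mv kk hL) μ x)))ᴴ) (u' k ((kingSec (cvM d L mv kk hL) L kk r) x) * U μ x * (u' k ((kingSec (cvM d L mv kk hL) L kk r) ((scShift d L mv kk hL) μ x)))ᴴ)ᴴ))) (Sum.inr μ) ((scShift d L mv kk hL) μ ((kingPr L kk r (cvM d L mv kk hL)) x'))) i j| ≤ oA) →
        (∀ k μ x' i, ∑ j, |fgradMat (((L ^ r * L ^ kk : ℕ) : ℝ)) ((scShift' d L mv kk r hL) μ) (fun x => (scBump' d L mv kk r hL k x • (tCoefA ((((L ^ r * L ^ kk : ℕ) : ℝ))⁻¹) (gaugePair (scShift' d L mv kk r hL) fun μ x => coordMat e (ContinuousLinearMap.mulLeftRight ℝ (Matrix m m ℂ) (u' k x * U' μ x * (u' k ((scShift' d L mv kk r hL) μ x))ᴴ) (u' k x * U' μ x * (u' k ((scShift' d L mv kk r hL) μ x))ᴴ)ᴴ))) (Sum.inl μ) x)) (((scShift' d L mv kk r hL) μ).symm x') i j - fgradMat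 (((L ^ kk : ℕ) : ℝ)) ((scShift d L mv kk hL) μ) (fun x => (scBump d L mv kk hL k x • (tCoefA ((((L ^ kk : ℕ) : ℝ))⁻¹) (gaugePair (scShift d L mv kk hL) fun μ x => coordMat e (ContinuousLinearMap.mulLeftRight ℝ (Matrix m m ℂ) (u' k ((kingSec (cvM d L mv kk hL) L kk r) x) * U μ x * (u' k ((kingSec (cvM d L mv kk hL) L kk r) ((scShift d L mv kk hL) μ x)))ᴴ) (u' k ((kingSec (cvM d L mv kk hL) L kk r) x) * U μ x * (u' k ((kingSec (cvM d L mv kk hL) L kk r) ((scShift d L mv kk hL) μ x)))ᴴ)ᴴ))) (Sum.inl μ) x)) (((scShift d L mv kk hL) μ).symm ((kingPr L kk r (cvM d L mv kk hL)) x')) i j| ≤ og) →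
        (∀ k μ x' i, ∑ j, |fgradMat (((L ^ r * L ^ kk : ℕ) : ℝ)) ((scShift' d L mv kk r hL) μ) (fun x => (scBump' d L mv kk r hL k x • (tCoefA ((((L ^ r * L ^ kk : ℕ) : ℝ))⁻¹) (gaugePair (scShift' d L mv kk r hL) fun μ x => coordMat e (ContinuousLinearMap.mulLeftRight ℝ (Matrix m m ℂ) (u' k x * U' μ x * (u' k ((scShift' d L mv kk r hL) μ x))ᴴ) (u' k x * U' μ x * (u' k ((scShift' d L mv kk r hL) μ x))ᴴ)ᴴ))) (Sum.inr μ) x)) x' i j - fgradMat (((L ^ kk : ℕ) : ℝ)) ((scShift d L mv kk hL) μ) (fun x => (scBump d L mv kk hL k x • (tCoefA ((((L ^ kk : ℕ) : ℝ))⁻¹) (gaugePair (scShift d L mv kk hL) fun μ x => coordMat e (ContinuousLinearMap.mulLeftRight ℝ (Matrix m m ℂ) (u' k ((kingSec (cvM d L mv kk hL) L kk r) x) * U μ x * (u' k ((kingSec (cvM d L mv kk hL) L kk r) ((scShift d L mv kk hL) μ x)))ᴴ) (u' k ((kingSec (cvM d L mv kk hL) L kk r) x) * U μ x * (u' k ((kingSec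 (cvM d L mv kk hL) L kk r) ((scShift d L mv kk hL) μ x)))ᴴ)ᴴ))) (Sum.inr μ) x)) ((kingPr L kk r (cvM d L mv kk hL)) x') i j| ≤ og) →
        (∀ k, HasMaj (ScNorm d L mv kk hL ι) ((BlockNorm.ofBlocks (unitTorusGeo L kk (cvM d L mv kk hL)) (liftBlk (scBlk d L mv kk hL ∘ kingPr L kk r (cvM d L mv kk hL)) ι))) (idef (pull (liftMap (kingPr L kk r (cvM d L mv kk hL)) ι)) (pull (liftMap (kingPr L kk r (cvM d L mv kk hL)) ι)) (mulOp (fun p : ScX' d L mv kk r hL × ι => scPsi' d L mv kk r hL k p.1) ∘ₗ (scNV' d L mv kk r hL (aK a₀ (L : ℝ) (r + kk) * (((L ^ r * L ^ kk : ℕ) : ℝ)) ^ (d + 1)) ι e u' U') k ∘ₗ mulOp (fun p : ScX' d L mv kk r hL × ι => scBump' d L mv kk r hL k p.1)) (mulOp (fun p : ScX d L mv kk hL × ι => scPsi d L mv kk hL k p.1) ∘ₗ (scNV d L mv kk hL (aK a₀ (L : ℝ) kk * (((L ^ kk : ℕ) : ℝ)) ^ (d + 1)) ι e (fun k x => u'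 k (kingSec (cvM d L mv kk hL) L kk r x)) U) k ∘ₗ mulOp (fun p : ScX d L mv kk hL × ι => scBump d L mv kk hL k p.1))) (fun y y' => oN * Real.exp (-(δ * (unitTorusGeo L kk (cvM d L mv kk hL)).dist y y')))) →
        (∀ k x' i, ∑ j, |(fun x' => scChi' d L mv kk r hL k x' • ((fun k y => -((fun x => coordMat e (ContinuousLinearMap.mulLeftRight ℝ (Matrix m m ℂ) (u' k x) (u' k x)ᴴ)) y * ((cvT e U') ν (((scShift' d L mv kk r hL) ν).symm y))ᵀ * ((fun x => coordMat e (ContinuousLinearMap.mulLeftRight ℝ (Matrix m m ℂ) (u' k x) (u' k x)ᴴ)) (((scShift' d L mv kk r hL) ν).symm y))ᵀ)) k ∘ ⇑((scShift' d L mv kk r hL) ν)) x') x' i j - (fun x => scChi d L mv kk hL k x • ((fun k y => -((fun x => coordMat e (ContinuousLinearMap.mulLeftRight ℝ (Matrix m m ℂ) (u' k (kingSec (cvM d L mv kk hL) L kk r x)) (u' k (kingSec (cvM d L mv kk hL) L kk r x))ᴴ)) y * ((cvT e U) ν (((scShift d L mv kk hL) ν).symm y))ᵀ * ((fun x => coordMat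 e (ContinuousLinearMap.mulLeftRight ℝ (Matrix m m ℂ) (u' k (kingSec (cvM d L mv kk hL) L kk r x)) (u' k (kingSec (cvM d L mv kk hL) L kk r x))ᴴ)) (((scShift d L mv kk hL) ν).symm y))ᵀ)) k ∘ ⇑((scShift d L mv kk hL) ν)) x) ((kingPr L kk r (cvM d L mv kk hL)) x') i j| ≤ oR) →
        (∀ k x' i, ∑ j, |(fun x' => scChi' d L mv kk r hL k x' • (fgradMat (((L ^ r * L ^ kk : ℕ) : ℝ)) ((scShift' d L mv kk r hL) ν) ((fun k y => -((fun x => coordMat e (ContinuousLinearMap.mulLeftRight ℝ (Matrix m m ℂ) (u' k x) (u' k x)ᴴ)) y * ((cvT e U') ν (((scShift' d L mv kk r hL) ν).symm y))ᵀ * ((fun x => coordMat e (ContinuousLinearMap.mulLeftRight ℝ (Matrix m m ℂ) (u' k x) (u' k x)ᴴ)) (((scShift' d L mv kk r hL) ν).symm y))ᵀ)) k)) x') x' i j - (fun x => scChi d L mv kk hL k x • (fgradMat (((L ^ kk : ℕ) : ℝ)) ((scShift d L mv kk hL) ν) ((fun k y => -((fun x => coordMat e (ContinuousLinearMap.mulLeftRight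 ℝ (Matrix m m ℂ) (u' k (kingSec (cvM d L mv kk hL) L kk r x)) (u' k (kingSec (cvM d L mv kk hL) L kk r x))ᴴ)) y * ((cvT e U) ν (((scShift d L mv kk hL) ν).symm y))ᵀ * ((fun x => coordMat e (ContinuousLinearMap.mulLeftRight ℝ (Matrix m m ℂ) (u' k (kingSec (cvM d L mv kk hL) L kk r x)) (u' k (kingSec (cvM d L mv kk hL) L kk r x))ᴴ)) (((scShift d L mv kk hL) ν).symm y))ᵀ)) k)) x) ((kingPr L kk r (cvM d L mv kk hL)) x') i j| ≤ oR') →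
        (∀ k x' i, ∑ j, |(fun x' => scChi' d L mv kk r hL k x' • (fun k y => (((L ^ r * L ^ kk : ℕ) : ℝ)) • ((fun x => coordMat e (ContinuousLinearMap.mulLeftRight ℝ (Matrix m m ℂ) (u' k x) (u' k x)ᴴ)) y * ((cvT e U') ν (((scShift' d L mv kk r hL) ν).symm y))ᵀ * ((fun x => coordMat e (ContinuousLinearMap.mulLeftRight ℝ (Matrix m m ℂ) (u' k x) (u' k x)ᴴ)) (((scShift' d L mv kk r hL) ν).symm y))ᵀ - 1)) k x') x' i j - (fun x => scChi d L mv kk hL k x • (fun k y => (((L ^ kk : ℕ) : ℝ)) • ((fun x => coordMat e (ContinuousLinearMap.mulLeftRight ℝ (Matrix m m ℂ) (u' k (kingSec (cvM d L mv kk hL) L kk r x)) (u' k (kingSec (cvM d L mv kk hL) L kk r x))ᴴ)) y * ((cvT e U) ν (((scShift d L mv kk hL) ν).symm y))ᵀ * ((fun x => coordMat e (ContinuousLinearMap.mulLeftRight ℝ (Matrix m m ℂ) (u' k (kingSec (cvM d L mv kk hL) L kk r x)) (u' k (kingSec (cvM d L mv kk hL) L kk r x))ᴴ)) (((scShift d L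 mv kk hL) ν).symm y))ᵀ - 1)) k x) ((kingPr L kk r (cvM d L mv kk hL)) x') i j| ≤ oB) →
        HasMaj (ScNorm d L mv kk hL ι) (BlockNorm.ofBlocks (unitTorusGeo L kk (cvM d L mv kk hL)) (liftBlk (scBlk d L mv kk hL ∘ kingPr L kk r (cvM d L mv kk hL)) ι)) (idef (ctauS (cvM d L mv kk hL) L kk r (fun μ x' => coordMat e (ContinuousLinearMap.mulLeftRight ℝ (Matrix m m ℂ) (U' μ x') (U' μ x')ᴴ))) (ctauS (cvM d L mv kk hL) L kk r (fun μ x' => coordMat e (ContinuousLinearMap.mulLeftRight ℝ (Matrix m m ℂ) (U' μ x') (U' μ x')ᴴ))) ((Matrix.mulVecLin (cGreen (cvM d L mv kk hL) (L ^ r * L ^ kk) (cvT e U') (aK a₀ (L : ℝ) (r + kk) * (((L ^ r * L ^ kk : ℕ) : ℝ)) ^ (d + 1)))) ∘ₗ (covD ((((L ^ r * L ^ kk : ℕ) : ℝ))⁻¹) (fun y => ((cvT e U') ν (((scShift' d L mv kk r hL) ν).symm y))ᵀ) ⇑((scShift' d L mv kk r hL) ν).symm)) ((Matrix.mulVecLin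 (cGreen (cvM d L mv kk hL) (L ^ kk) (cvT e U) (aK a₀ (L : ℝ) kk * (((L ^ kk : ℕ) : ℝ)) ^ (d + 1)))) ∘ₗ (covD ((((L ^ kk : ℕ) : ℝ))⁻¹) (fun y => ((cvT e U) ν (((scShift d L mv kk hL) ν).symm y))ᵀ) ⇑((scShift d L mv kk hL) ν).symm)))
          (fun y y' => D * ((((L : ℝ) ^ kk) ^ (-(1 / 4 : ℝ))) + (o + (((1 + (Fintype.card ι * (((((L ^ r * L ^ kk : ℕ) : ℝ))⁻¹) * (@basisConst ι _ (Matrix m m ℂ) Matrix.frobeniusNormedAddCommGroup Matrix.frobeniusNormedSpace e * (2 * Real.sqrt (Fintype.card m)) * (Real.sqrt (Fintype.card m) * p))))) ^ ((d + 1) * (L ^ r - 1)) - 1)))) * Real.exp (-(δ / 16 * (unitTorusGeo L kk (cvM d L mv kk hL)).dist y y'))) := by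
  obtain ⟨δ, w₀, R₀, θ₀, hδ, hR₀, hθ₀, HR⟩ := uN_idef_scAdj_rightInverse_tr (d := d) hL hL7 ha₀ ι
  obtain ⟨D, H⟩ := HR (1 + R₀) (by positivity)
  have hL1r : (1 : ℝ) < (L : ℝ) := (by exact_mod_cast hL.2); have hL3 : 3 ≤ L := (by omega); have hLpos : 0 < L := (by omega)
  refine ⟨δ, max w₀ 3, R₀, |D| * (1 + (64 * π ^ 2 + π ^ 2 * Fintype.card (Fin (d + 1)))), hδ, hR₀, fun mv kk r hk hr hw₀ => ?_⟩
  intro m _ _ e he u' hu' U hU U' hU' Qf Qc p q hp hq hQf hQρ hQc hF1 hF2 hC1 hC2 rV oC oA og oN oR oR' oB o hrV hoC hoA hog hoN hoR hoR' hoB hrA hrC hrQ hRle hole hfitCt hfitAt hfAsh1 hfAsh2 hfgAf hfgAb hDNVc hfRE hfRE' hfBE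
  have hnr : (0 : ℝ) < ((L ^ kk : ℕ) : ℝ) := Nat.cast_pos.mpr (pow_pos (by omega) kk)
  have hnr' : (0 : ℝ) < ((L ^ r * L ^ kk : ℕ) : ℝ) := Nat.cast_pos.mpr (Nat.mul_pos (pow_pos (by omega) r) (pow_pos (by omega) kk))
  have hn1 : (1 : ℝ) ≤ ((L ^ kk : ℕ) : ℝ) := by exact_mod_cast Nat.one_le_pow _ _ hLpos
  have hn1' : (1 : ℝ) ≤ ((L ^ r * L ^ kk : ℕ) : ℝ) := by exact_mod_cast Nat.mul_pos (Nat.one_le_pow _ _ hLpos) (Nat.one_le_pow _ _ hLpos)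
  have hw₀' : w₀ ≤ ((L ^ mv : ℕ) : ℝ) := (le_max_left _ _).trans hw₀
  have hW3 : 3 ≤ L ^ mv := by have h := (le_max_right w₀ 3).trans hw₀; exact_mod_cast h
  have hW2 : 2 ≤ L ^ mv := (by omega); have hw : 0 < L ^ mv := (by omega); have hW1 : (1 : ℝ) ≤ ((L ^ mv : ℕ) : ℝ) := (by exact_mod_cast hw); have hWpos : (0 : ℝ) < ((L ^ mv : ℕ) : ℝ) := (by exact_mod_cast hw)
  have hη : (0 : ℝ) < ((((L ^ kk : ℕ) : ℝ))⁻¹) := inv_pos.mpr hnr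
  have hη' : (0 : ℝ) < ((((L ^ r * L ^ kk : ℕ) : ℝ))⁻¹) := inv_pos.mpr hnr'
  have hηle : ((((L ^ kk : ℕ) : ℝ))⁻¹) ≤ 1 := inv_le_one_of_one_le₀ hn1
  have hη'le : ((((L ^ r * L ^ kk : ℕ) : ℝ))⁻¹) ≤ 1 := inv_le_one_of_one_le₀ hn1'
  have hM : ∀ ν, cvM d L mv kk hL ν = 2 * L * L ^ mv := MP_succ_eq L mv kk hL
  have hm₁ : 2 * L ^ mv ≤ coverMargin L mv := two_mul_le_coverMargin hL7 mv
  have hfitI : coverMargin L mv - 2 * L ^ mv + (6 * L ^ mv + 1) ≤ L * L ^ mv := coverMargin_inner_fit hL7 hW2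
  have hS0 : L * L ^ mv ≤ 2 * L * L ^ mv := (by rw [mul_assoc]; omega)
  have hmg₂ : 2 * L ^ mv + 1 ≤ coverMargin L mv := (coverMargin_cut_margin hL7 hW3).1
  have hfg₂ : coverMargin L mv - 2 * L ^ mv + (6 * L ^ mv + 1) + 1 ≤ L * L ^ mv := (coverMargin_cut_margin hL7 hW3).2
  have hS6 : 6 * L ^ mv + 1 ≤ 2 * L * L ^ mv := by
    have h7 : 7 * L ^ mv ≤ L * L ^ mv := Nat.mul_le_mul_right _ hL7
    have e7 : 2 * L * L ^ mv = 2 * (L * L ^ mv) := by ring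
    rw [e7]; omega
  have hK0 : 0 < 2 * L := by omega
  -- King's windows at both indices, the named right inverses
  have haK : 0 < aK a₀ (L : ℝ) kk := aK_pos ha₀ hL1r hk
  have haKle : aK a₀ (L : ℝ) kk ≤ a₀ := aK_le ha₀ hL1r hk
  have ha' : 0 < (aK a₀ (L : ℝ) kk * (((L ^ kk : ℕ) : ℝ)) ^ (d + 1)) := by positivity
  have haK' : 0 < aK a₀ (L : ℝ) (r + kk) := aK_pos ha₀ hL1r (hk.trans (Nat.le_add_left kk r))
  have haKle' : aK a₀ (L : ℝ) (r + kk) ≤ a₀ := aK_le ha₀ hL1r (hk.trans (Nat.le_add_left kk r))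
  have ha'' : 0 < (aK a₀ (L : ℝ) (r + kk) * (((L ^ r * L ^ kk : ℕ) : ℝ)) ^ (d + 1)) := by positivity
  have habs : |(aK a₀ (L : ℝ) kk * (((L ^ kk : ℕ) : ℝ)) ^ (d + 1))| * ((((L ^ kk : ℕ) : ℝ)) ^ (d + 1))⁻¹ = aK a₀ (L : ℝ) kk := by rw [abs_of_pos ha', mul_assoc, mul_inv_cancel₀ (by positivity), mul_one]
  have habs' : |(aK a₀ (L : ℝ) (r + kk) * (((L ^ r * L ^ kk : ℕ) : ℝ)) ^ (d + 1))| * ((((L ^ r * L ^ kk : ℕ) : ℝ)) ^ (d + 1))⁻¹ = aK a₀ (L : ℝ) (r + kk) := by rw [abs_of_pos ha'', mul_assoc, mul_inv_cancel₀ (by positivity), mul_one]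
  have hY : (covLapM (scShift d L mv kk hL) ((((L ^ kk : ℕ) : ℝ))⁻¹) (gaugePair (scShift d L mv kk hL) (fun μ x => coordMat e (ContinuousLinearMap.mulLeftRight ℝ (Matrix m m ℂ) (U μ x) (U μ x)ᴴ))) + (scP d L mv kk hL (aK a₀ (L : ℝ) kk * (((L ^ kk : ℕ) : ℝ)) ^ (d + 1)) ι e U)) ∘ₗ (Matrix.mulVecLin (cGreen (cvM d L mv kk hL) (L ^ kk) (cvT e U) (aK a₀ (L : ℝ) kk * (((L ^ kk : ℕ) : ℝ)) ^ (d + 1)))) = LinearMap.id := by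
    rw [covLapM_add_scP_eq_mulVecLin_claplA ι e he (aK a₀ (L : ℝ) kk * (((L ^ kk : ℕ) : ℝ)) ^ (d + 1)) U hU, ← Matrix.mulVecLin_mul, claplA_mul_cGreen _ _ (isUnit_cvT ι e he U hU) ha', Matrix.mulVecLin_one]
  have hY' : (covLapM (scShift' d L mv kk r hL) ((((L ^ r * L ^ kk : ℕ) : ℝ))⁻¹) (gaugePair (scShift' d L mv kk r hL) (fun μ x => coordMat e (ContinuousLinearMap.mulLeftRight ℝ (Matrix m m ℂ) (U' μ x) (U' μ x)ᴴ))) + (scP' d L mv kk r hL (aK a₀ (L : ℝ) (r + kk) * (((L ^ r * L ^ kk : ℕ) : ℝ)) ^ (d + 1)) ι e U')) ∘ₗ (Matrix.mulVecLin (cGreen (cvM d L mv kk hL) (L ^ r * L ^ kk) (cvT e U') (aK a₀ (L : ℝ) (r + kk) * (((L ^ r * L ^ kk : ℕ) : ℝ)) ^ (d + 1)))) = LinearMap.id := by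
    rw [covLapM_add_scP'_eq_mulVecLin_claplA ι e he (aK a₀ (L : ℝ) (r + kk) * (((L ^ r * L ^ kk : ℕ) : ℝ)) ^ (d + 1)) U' hU', ← Matrix.mulVecLin_mul, claplA_mul_cGreen _ _ (isUnit_cvT ι e he U' hU') ha'', Matrix.mulVecLin_one]
  -- the letters of the cut rows
  have hσc0 : 0 ≤ ((1 + rV * ((((L ^ kk : ℕ) : ℝ))⁻¹)) ^ ((d + 1) * L ^ kk) - 1) := by
    have := one_le_pow₀ (M₀ := ℝ) (a := 1 + rV * ((((L ^ kk : ℕ) : ℝ))⁻¹)) (by nlinarith [hη.le]) (n := (d + 1) * L ^ kk); linarith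
  have hσf0 : 0 ≤ ((1 + rV * ((((L ^ r * L ^ kk : ℕ) : ℝ))⁻¹)) ^ ((d + 1) * (L ^ r * L ^ kk)) - 1) := by
    have := one_le_pow₀ (M₀ := ℝ) (a := 1 + rV * ((((L ^ r * L ^ kk : ℕ) : ℝ))⁻¹)) (by nlinarith [hη'.le]) (n := (d + 1) * (L ^ r * L ^ kk)); linarith
  have hSc0 : 0 ≤ (Fintype.card ι * (Fintype.card ι * ((1 + rV * ((((L ^ kk : ℕ) : ℝ))⁻¹)) ^ ((d + 1) * L ^ kk) - 1) ^ 2 + 2 * ((1 + rV * ((((L ^ kk : ℕ) : ℝ))⁻¹)) ^ ((d + 1) * L ^ kk) - 1))) := (by positivity); have hSf0 : 0 ≤ (Fintype.card ι * (Fintype.card ι * ((1 + rV * ((((L ^ r * L ^ kk : ℕ) : ℝ))⁻¹)) ^ ((d + 1) * (L ^ r * L ^ kk)) - 1) ^ 2 + 2 * ((1 + rV * ((((L ^ r * L ^ kk : ℕ) : ℝ))⁻¹)) ^ ((d + 1) * (L ^ r * L ^ kk)) - 1))) := (by positivity)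
  have hRN0 : 0 ≤ (a₀ * (Fintype.card ι * (Fintype.card ι * ((1 + rV * ((((L ^ kk : ℕ) : ℝ))⁻¹)) ^ ((d + 1) * L ^ kk) - 1) ^ 2 + 2 * ((1 + rV * ((((L ^ kk : ℕ) : ℝ))⁻¹)) ^ ((d + 1) * L ^ kk) - 1))) + a₀ * (Fintype.card ι * (Fintype.card ι * ((1 + rV * ((((L ^ r * L ^ kk : ℕ) : ℝ))⁻¹)) ^ ((d + 1) * (L ^ r * L ^ kk)) - 1) ^ 2 + 2 * ((1 + rV * ((((L ^ r * L ^ kk : ℕ) : ℝ))⁻¹)) ^ ((d + 1) * (L ^ r * L ^ kk)) - 1)))) := by positivity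
  have hJ0 : (0 : ℝ) ≤ Fintype.card (Fin (d + 1) ⊕ Fin (d + 1)) := by positivity
  have hrVle : rV ≤ R₀ := by nlinarith [hRle, hRN0, hrV, hJ0]
  -- the induced coarse gauge, the transformed bond variables, unitarity ∕ orthogonality
  have hW : ∀ (k : (Fin (d + 1) → ZMod (2 * L))) (x : ScX d L mv kk hL), ((fun k x => u' k (kingSec (cvM d L mv kk hL) L kk r x)) k x)ᴴ * (fun k x => u' k (kingSec (cvM d L mv kk hL) L kk r x)) k x = 1 := fun k x => hu' k _
  have hV'u : ∀ (k : (Fin (d + 1) → ZMod (2 * L))) (μ : Fin (d + 1)) (z : ScX' d L mv kk r hL), (u' k z * U' μ z * (u' k ((scShift' d L mv kk r hL) μ z))ᴴ)ᴴ * (u' k z * U' μ z * (u' k ((scShift' d L mv kk r hL) μ z))ᴴ) = 1 := fun k μ z => uN_gaugeTransformed_bond_unitary (scShift' d L mv kk r hL) (u' k) U' (hu' k) hU' μ z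
  have hVu : ∀ (k : (Fin (d + 1) → ZMod (2 * L))) (μ : Fin (d + 1)) (x : ScX d L mv kk hL), (u' k (kingSec (cvM d L mv kk hL) L kk r x) * U μ x * (u' k (kingSec (cvM d L mv kk hL) L kk r ((scShift d L mv kk hL) μ x)))ᴴ)ᴴ * (u' k (kingSec (cvM d L mv kk hL) L kk r x) * U μ x * (u' k (kingSec (cvM d L mv kk hL) L kk r ((scShift d L mv kk hL) μ x)))ᴴ) = 1 := fun k μ x => uN_gaugeTransformed_bond_unitary (scShift d L mv kk hL) ((fun k x => u' k (kingSec (cvM d L mv kk hL) L kk r x)) k) U (hW k) hU μ x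
  have hκ0 : 0 ≤ @basisConst ι _ (Matrix m m ℂ) Matrix.frobeniusNormedAddCommGroup Matrix.frobeniusNormedSpace e * (2 * Real.sqrt (Fintype.card m)) := mul_nonneg (@basisConst_nonneg ι _ (Matrix m m ℂ) Matrix.frobeniusNormedAddCommGroup Matrix.frobeniusNormedSpace e) (by positivity)
  have hP10 : 0 ≤ (@basisConst ι _ (Matrix m m ℂ) Matrix.frobeniusNormedAddCommGroup Matrix.frobeniusNormedSpace e * (2 * Real.sqrt (Fintype.card m)) * (Real.sqrt (Fintype.card m) * p)) := by positivity
  have hQ10 : 0 ≤ (@basisConst ι _ (Matrix m m ℂ) Matrix.frobeniusNormedAddCommGroup Matrix.frobeniusNormedSpace e * (2 * Real.sqrt (Fintype.card m)) * (Real.sqrt (Fintype.card m) * q)) := by positivity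
  -- the entry letters (dag-n15-w2 §2), both grids
  have hE1' : ∀ (k : (Fin (d + 1) → ZMod (2 * L))) (μ : Fin (d + 1)) (z : ScX' d L mv kk r hL), z ∈ Qf k → ∀ i j, |((fun μ x => coordMat e (ContinuousLinearMap.mulLeftRight ℝ (Matrix m m ℂ) ((u' k x * U' μ x * (u' k ((scShift' d L mv kk r hL) μ x))ᴴ)) ((u' k x * U' μ x * (u' k ((scShift' d L mv kk r hL) μ x))ᴴ))ᴴ)) μ z - 1) i j| ≤ ((((L ^ r * L ^ kk : ℕ) : ℝ))⁻¹) * (@basisConst ι _ (Matrix m m ℂ) Matrix.frobeniusNormedAddCommGroup Matrix.frobeniusNormedSpace e * (2 * Real.sqrt (Fintype.card m)) * (Real.sqrt (Fintype.card m) * p)) := fun k μ z hz i j => by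
    refine (uN_abs_coordMat_conj_sub_one_entry_le_op e (hV'u k μ z) i j).trans ?_
    calc @basisConst ι _ (Matrix m m ℂ) Matrix.frobeniusNormedAddCommGroup Matrix.frobeniusNormedSpace e * (2 * Real.sqrt (Fintype.card m)) * (Real.sqrt (Fintype.card m) * ‖(u' k z * U' μ z * (u' k ((scShift' d L mv kk r hL) μ z))ᴴ) - 1‖) ≤ @basisConst ι _ (Matrix m m ℂ) Matrix.frobeniusNormedAddCommGroup Matrix.frobeniusNormedSpace e * (2 * Real.sqrt (Fintype.card m)) * (Real.sqrt (Fintype.card m) * (((((L ^ r * L ^ kk : ℕ) : ℝ))⁻¹) * p)) := mul_le_mul_of_nonneg_left (mul_le_mul_of_nonneg_left (hF1 k μ z hz) (by positivity)) hκ0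
      _ = ((((L ^ r * L ^ kk : ℕ) : ℝ))⁻¹) * (@basisConst ι _ (Matrix m m ℂ) Matrix.frobeniusNormedAddCommGroup Matrix.frobeniusNormedSpace e * (2 * Real.sqrt (Fintype.card m)) * (Real.sqrt (Fintype.card m) * p)) := by ring
  have hE2' : ∀ (k : (Fin (d + 1) → ZMod (2 * L))) (μ : Fin (d + 1)) (z : ScX' d L mv kk r hL), z ∈ Qf k → ∀ i j, |((fun μ x => coordMat e (ContinuousLinearMap.mulLeftRight ℝ (Matrix m m ℂ) ((u' k x * U' μ x * (u' k ((scShift' d L mv kk r hL) μ x))ᴴ)) ((u' k x * U' μ x * (u' k ((scShift' d L mv kk r hL) μ x))ᴴ))ᴴ)) μ z - (fun μ x => coordMat e (ContinuousLinearMap.mulLeftRight ℝ (Matrix m m ℂ) ((u' k x * U' μ x * (u' k ((scShift' d L mv kk r hL) μ x))ᴴ)) ((u' k x * U' μ x * (u' k ((scShift' d L mv kk r hL) μ x))ᴴ))ᴴ)) μ (((scShift' d L mv kk r hL) μ).symm z)) i j| ≤ ((((L ^ r * L ^ kk : ℕ) : ℝ))⁻¹) ^ 2 * (@basisConst ι _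 (Matrix m m ℂ) Matrix.frobeniusNormedAddCommGroup Matrix.frobeniusNormedSpace e * (2 * Real.sqrt (Fintype.card m)) * (Real.sqrt (Fintype.card m) * q)) := fun k μ z hz i j => by
    refine (uN_abs_coordMat_conj_sub_conj_entry_le_op e (hV'u k μ (((scShift' d L mv kk r hL) μ).symm z)) (hV'u k μ z) i j).trans ?_
    calc @basisConst ι _ (Matrix m m ℂ) Matrix.frobeniusNormedAddCommGroup Matrix.frobeniusNormedSpace e * (2 * Real.sqrt (Fintype.card m)) * (Real.sqrt (Fintype.card m) * ‖(u' k z * U' μ z * (u' k ((scShift' d L mv kk r hL) μ z))ᴴ) - (u' k (((scShift' d L mv kk r hL) μ).symm z) * U' μ (((scShift' d L mv kk r hL) μ).symm z) * (u' k ((scShift' d L mv kk r hL) μ (((scShift' d L mv kk r hL) μ).symm z)))ᴴ)‖) ≤ @basisConst ι _ (Matrix m m ℂ) Matrix.frobeniusNormedAddCommGroup Matrix.frobeniusNormedSpace e * (2 * Real.sqrt (Fintype.card m)) * (Real.sqrt (Fintype.card m) * (((((L ^ r * L ^ kk : ℕ) : ℝ))⁻¹) ^ 2 * q)) := mul_le_mul_of_nonneg_left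 (mul_le_mul_of_nonneg_left (hF2 k μ z hz) (by positivity)) hκ0
      _ = ((((L ^ r * L ^ kk : ℕ) : ℝ))⁻¹) ^ 2 * (@basisConst ι _ (Matrix m m ℂ) Matrix.frobeniusNormedAddCommGroup Matrix.frobeniusNormedSpace e * (2 * Real.sqrt (Fintype.card m)) * (Real.sqrt (Fintype.card m) * q)) := by ring
  have hE1 : ∀ (k : (Fin (d + 1) → ZMod (2 * L))) (μ : Fin (d + 1)) (x : ScX d L mv kk hL), x ∈ Qc k → ∀ i j, |((fun μ x => coordMat e (ContinuousLinearMap.mulLeftRight ℝ (Matrix m m ℂ) ((u' k (kingSec (cvM d L mv kk hL) L kk r x) * U μ x * (u' k (kingSec (cvM d L mv kk hL) L kk r ((scShift d L mv kk hL) μ x)))ᴴ)) ((u' k (kingSec (cvM d L mv kk hL) L kk r x) * U μ x * (u' k (kingSec (cvM d L mv kk hL) L kk r ((scShift d L mv kk hL) μ x)))ᴴ))ᴴ)) μ x - 1) i j| ≤ ((((L ^ kk : ℕ) : ℝ))⁻¹) * (@basisConst ι _ (Matrix m m ℂ) Matrix.frobeniusNormedAddCommGroup Matrix.frobeniusNormedSpace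 e * (2 * Real.sqrt (Fintype.card m)) * (Real.sqrt (Fintype.card m) * p)) := fun k μ x hx i j => by
    refine (uN_abs_coordMat_conj_sub_one_entry_le_op e (hVu k μ x) i j).trans ?_
    calc @basisConst ι _ (Matrix m m ℂ) Matrix.frobeniusNormedAddCommGroup Matrix.frobeniusNormedSpace e * (2 * Real.sqrt (Fintype.card m)) * (Real.sqrt (Fintype.card m) * ‖(u' k (kingSec (cvM d L mv kk hL) L kk r x) * U μ x * (u' k (kingSec (cvM d L mv kk hL) L kk r ((scShift d L mv kk hL) μ x)))ᴴ) - 1‖) ≤ @basisConst ι _ (Matrix m m ℂ) Matrix.frobeniusNormedAddCommGroup Matrix.frobeniusNormedSpace e * (2 * Real.sqrt (Fintype.card m)) * (Real.sqrt (Fintype.card m) * (((((L ^ kk : ℕ) : ℝ))⁻¹) * p)) := mul_le_mul_of_nonneg_left (mul_le_mul_of_nonneg_left (hC1 k μ x hx) (by positivity)) hκ0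
      _ = ((((L ^ kk : ℕ) : ℝ))⁻¹) * (@basisConst ι _ (Matrix m m ℂ) Matrix.frobeniusNormedAddCommGroup Matrix.frobeniusNormedSpace e * (2 * Real.sqrt (Fintype.card m)) * (Real.sqrt (Fintype.card m) * p)) := by ring
  have hE2 : ∀ (k : (Fin (d + 1) → ZMod (2 * L))) (μ : Fin (d + 1)) (x : ScX d L mv kk hL), x ∈ Qc k → ∀ i j, |((fun μ x => coordMat e (ContinuousLinearMap.mulLeftRight ℝ (Matrix m m ℂ) ((u' k (kingSec (cvM d L mv kk hL) L kk r x) * U μ x * (u' k (kingSec (cvM d L mv kk hL) L kk r ((scShift d L mv kk hL) μ x)))ᴴ)) ((u' k (kingSec (cvM d L mv kk hL) L kk r x) * U μ x * (u' k (kingSec (cvM d L mv kk hL) L kk r ((scShift d L mv kk hL) μ x)))ᴴ))ᴴ)) μ x - (fun μ x => coordMat e (ContinuousLinearMap.mulLeftRight ℝ (Matrix m m ℂ) ((u' k (kingSec (cvM d L mv kk hL) L kk r x) * U μ x * (u' k (kingSec (cvM d L mv kk hL) L kk r ((scShift d L mv kk hL) μ x)))ᴴ)) ((u' k (kingSec (cvM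 d L mv kk hL) L kk r x) * U μ x * (u' k (kingSec (cvM d L mv kk hL) L kk r ((scShift d L mv kk hL) μ x)))ᴴ))ᴴ)) μ (((scShift d L mv kk hL) μ).symm x)) i j| ≤ ((((L ^ kk : ℕ) : ℝ))⁻¹) ^ 2 * (@basisConst ι _ (Matrix m m ℂ) Matrix.frobeniusNormedAddCommGroup Matrix.frobeniusNormedSpace e * (2 * Real.sqrt (Fintype.card m)) * (Real.sqrt (Fintype.card m) * q)) := fun k μ x hx i j => by
    refine (uN_abs_coordMat_conj_sub_conj_entry_le_op e (hVu k μ (((scShift d L mv kk hL) μ).symm x)) (hVu k μ x) i j).trans ?_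
    calc @basisConst ι _ (Matrix m m ℂ) Matrix.frobeniusNormedAddCommGroup Matrix.frobeniusNormedSpace e * (2 * Real.sqrt (Fintype.card m)) * (Real.sqrt (Fintype.card m) * ‖(u' k (kingSec (cvM d L mv kk hL) L kk r x) * U μ x * (u' k (kingSec (cvM d L mv kk hL) L kk r ((scShift d L mv kk hL) μ x)))ᴴ) - (u' k (kingSec (cvM d L mv kk hL) L kk r (((scShift d L mv kk hL) μ).symm x)) * U μ (((scShift d L mv kk hL) μ).symm x) * (u' k (kingSec (cvM d L mv kk hL) L kk r ((scShift d L mv kk hL) μ (((scShift d L mv kk hL) μ).symm x))))ᴴ)‖) ≤ @basisConst ι _ (Matrix m m ℂ) Matrix.frobeniusNormedAddCommGroup Matrix.frobeniusNormedSpace e * (2 * Real.sqrt (Fintype.card m)) * (Real.sqrt (Fintype.card m) * (((((L ^ kk : ℕ) : ℝ))⁻¹) ^ 2 * q)) := mul_le_mul_of_nonneg_left (mul_le_mul_of_nonneg_left (hC2 k μ x hx) (by positivity)) hκ0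
      _ = ((((L ^ kk : ℕ) : ℝ))⁻¹) ^ 2 * (@basisConst ι _ (Matrix m m ℂ) Matrix.frobeniusNormedAddCommGroup Matrix.frobeniusNormedSpace e * (2 * Real.sqrt (Fintype.card m)) * (Real.sqrt (Fintype.card m) * q)) := by ring
  have hSo' : ∀ (k : (Fin (d + 1) → ZMod (2 * L))) (μ : Fin (d + 1)) (z : ScX' d L mv kk r hL), (fun μ x => coordMat e (ContinuousLinearMap.mulLeftRight ℝ (Matrix m m ℂ) ((u' k x * U' μ x * (u' k ((scShift' d L mv kk r hL) μ x))ᴴ)) ((u' k x * U' μ x * (u' k ((scShift' d L mv kk r hL) μ x))ᴴ))ᴴ)) μ z * ((fun μ x => coordMat e (ContinuousLinearMap.mulLeftRight ℝ (Matrix m m ℂ) ((u' k x * U' μ x * (u' k ((scShift' d L mv kk r hL) μ x))ᴴ)) ((u' k x * U' μ x * (u' k ((scShift' d L mv kk r hL) μ x))ᴴ))ᴴ)) μ z)ᵀ = 1 := fun k μ z => (uN_coordMat_conj_orthogonal e he (hV'u k μ z)).2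
  have hSo : ∀ (k : (Fin (d + 1) → ZMod (2 * L))) (μ : Fin (d + 1)) (x : ScX d L mv kk hL), (fun μ x => coordMat e (ContinuousLinearMap.mulLeftRight ℝ (Matrix m m ℂ) ((u' k (kingSec (cvM d L mv kk hL) L kk r x) * U μ x * (u' k (kingSec (cvM d L mv kk hL) L kk r ((scShift d L mv kk hL) μ x)))ᴴ)) ((u' k (kingSec (cvM d L mv kk hL) L kk r x) * U μ x * (u' k (kingSec (cvM d L mv kk hL) L kk r ((scShift d L mv kk hL) μ x)))ᴴ))ᴴ)) μ x * ((fun μ x => coordMat e (ContinuousLinearMap.mulLeftRight ℝ (Matrix m m ℂ) ((u' k (kingSec (cvM d L mv kk hL) L kk r x) * U μ x * (u' k (kingSec (cvM d L mv kk hL) L kk r ((scShift d L mv kk hL) μ x)))ᴴ)) ((u' k (kingSec (cvM d L mv kk hL) L kk r x) * U μ x * (u' k (kingSec (cvM d L mv kk hL) L kk r ((scShift d L mv kk hL) μ x)))ᴴ))ᴴ)) μ x)ᵀ = 1 := fun k μ x => (uN_coordMat_conj_orthogonal e he (hVu k μ x)).2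
  -- the coefficient letters (values and QUOTIENTS), both grids
  have hAloc' : ∀ k j' x', scChi' d L mv kk r hL k x' ≠ 0 → ∀ i, ∑ j, |tCoefA ((((L ^ r * L ^ kk : ℕ) : ℝ))⁻¹) (gaugePair (scShift' d L mv kk r hL) (fun μ x => coordMat e (ContinuousLinearMap.mulLeftRight ℝ (Matrix m m ℂ) ((u' k x * U' μ x * (u' k ((scShift' d L mv kk r hL) μ x))ᴴ)) ((u' k x * U' μ x * (u' k ((scShift' d L mv kk r hL) μ x))ᴴ))ᴴ))) j' x' i j| ≤ rV := fun k j' x' hx' i => by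
    obtain ⟨h0, h2, -⟩ := hQf k x' hx'
    cases j' with
    | inl μ => exact (rowSum_tCoefA_inl_le_at ((((L ^ r * L ^ kk : ℕ) : ℝ))⁻¹) (scShift' d L mv kk r hL) _ hη' (hE1' k μ x' h0) i).trans hrA
    | inr μ => exact (rowSum_tCoefA_inr_le_at ((((L ^ r * L ^ kk : ℕ) : ℝ))⁻¹) (scShift' d L mv kk r hL) _ hη' (hE1' k μ _ (h2 μ)) i).trans hrA
  have hCloc' : ∀ k x', scChi' d L mv kk r hL k x' ≠ 0 → ∀ i, ∑ j, |tCoefC ((((L ^ r * L ^ kk : ℕ) : ℝ))⁻¹) (gaugePair (scShift' d L mv kk r hL) (fun μ x => coordMat e (ContinuousLinearMap.mulLeftRight ℝ (Matrix m m ℂ) ((u' k x * U' μ x * (u' k ((scShift' d L mv kk r hL) μ x))ᴴ)) ((u' k x * U' μ x * (u' k ((scShift' d L mv kk r hL) μ x))ᴴ))ᴴ))) x' i j| ≤ rV := fun k x' hx' i =>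
    (rowSum_tCoefC_le_at ((((L ^ r * L ^ kk : ℕ) : ℝ))⁻¹) (scShift' d L mv kk r hL) _ hη' hP10 (hSo' k) (fun μ => hE1' k μ x' (hQf k x' hx').1) (fun μ => hE2' k μ x' (hQf k x' hx').1) i).trans hrC
  have hAloc : ∀ k j' x, scChi d L mv kk hL k x ≠ 0 → ∀ i, ∑ j, |tCoefA ((((L ^ kk : ℕ) : ℝ))⁻¹) (gaugePair (scShift d L mv kk hL) (fun μ x => coordMat e (ContinuousLinearMap.mulLeftRight ℝ (Matrix m m ℂ) ((u' k (kingSec (cvM d L mv kk hL) L kk r x) * U μ x * (u' k (kingSec (cvM d L mv kk hL) L kk r ((scShift d L mv kk hL) μ x)))ᴴ)) ((u' k (kingSec (cvM d L mv kk hL) L kk r x) * U μ x * (u' k (kingSec (cvM d L mv kk hL) L kk r ((scShift d L mv kk hL) μ x)))ᴴ))ᴴ))) j' x i j| ≤ rV := fun k j' x hx i => by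
    obtain ⟨h0, h2, -⟩ := hQc k x hx
    cases j' with
    | inl μ => exact (rowSum_tCoefA_inl_le_at ((((L ^ kk : ℕ) : ℝ))⁻¹) (scShift d L mv kk hL) _ hη (hE1 k μ x h0) i).trans hrA
    | inr μ => exact (rowSum_tCoefA_inr_le_at ((((L ^ kk : ℕ) : ℝ))⁻¹) (scShift d L mv kk hL) _ hη (hE1 k μ _ (h2 μ)) i).trans hrA
  have hCloc : ∀ k x, scChi d L mv kk hL k x ≠ 0 → ∀ i, ∑ j, |tCoefC ((((L ^ kk : ℕ) : ℝ))⁻¹) (gaugePair (scShift d L mv kk hL) (fun μ x => coordMat e (ContinuousLinearMap.mulLeftRight ℝ (Matrix m m ℂ) ((u' k (kingSec (cvM d L mv kk hL) L kk r x) * U μ x * (u' k (kingSec (cvM d L mv kk hL) L kk r ((scShift d L mv kk hL) μ x)))ᴴ)) ((u' k (kingSec (cvM d L mv kk hL) L kk r x) * U μ x * (u' k (kingSec (cvM d L mv kk hL) L kk r ((scShift d L mv kk hL) μ x)))ᴴ))ᴴ))) x i j| ≤ rV := fun k x hx i =>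
    (rowSum_tCoefC_le_at ((((L ^ kk : ℕ) : ℝ))⁻¹) (scShift d L mv kk hL) _ hη hP10 (hSo k) (fun μ => hE1 k μ x (hQc k x hx).1) (fun μ => hE2 k μ x (hQc k x hx).1) i).trans hrC
  have hqι' : Fintype.card ι * (((((L ^ r * L ^ kk : ℕ) : ℝ))⁻¹) * (@basisConst ι _ (Matrix m m ℂ) Matrix.frobeniusNormedAddCommGroup Matrix.frobeniusNormedSpace e * (2 * Real.sqrt (Fintype.card m)) * (Real.sqrt (Fintype.card m) * q))) ≤ rV := (mul_le_mul_of_nonneg_left (mul_le_of_le_one_left hQ10 hη'le) (Nat.cast_nonneg _)).trans hrQ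
  have hqι : Fintype.card ι * (((((L ^ kk : ℕ) : ℝ))⁻¹) * (@basisConst ι _ (Matrix m m ℂ) Matrix.frobeniusNormedAddCommGroup Matrix.frobeniusNormedSpace e * (2 * Real.sqrt (Fintype.card m)) * (Real.sqrt (Fintype.card m) * q))) ≤ rV := (mul_le_mul_of_nonneg_left (mul_le_of_le_one_left hQ10 hηle) (Nat.cast_nonneg _)).trans hrQ
  have hDAf' : ∀ k μ x', scChi' d L mv kk r hL k x' ≠ 0 → ∀ i, ∑ j, |fgradMat (((L ^ r * L ^ kk : ℕ) : ℝ)) ((scShift' d L mv kk r hL) μ) (tCoefA ((((L ^ r * L ^ kk : ℕ) : ℝ))⁻¹) (gaugePair (scShift' d L mv kk r hL) (fun μ x => coordMat e (ContinuousLinearMap.mulLeftRight ℝ (Matrix m m ℂ) ((u' k x * U' μ x * (u' k ((scShift' d L mv kk r hL) μ x))ᴴ)) ((u' k x * U' μ x * (u' k ((scShift' d L mv kk r hL) μ x))ᴴ))ᴴ))) (Sum.inl μ)) x' i j| ≤ rV := fun k μ x' hx' i => by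
    have hS : ∀ i j, |((fun μ x => coordMat e (ContinuousLinearMap.mulLeftRight ℝ (Matrix m m ℂ) ((u' k x * U' μ x * (u' k ((scShift' d L mv kk r hL) μ x))ᴴ)) ((u' k x * U' μ x * (u' k ((scShift' d L mv kk r hL) μ x))ᴴ))ᴴ)) μ ((scShift' d L mv kk r hL) μ x') - (fun μ x => coordMat e (ContinuousLinearMap.mulLeftRight ℝ (Matrix m m ℂ) ((u' k x * U' μ x * (u' k ((scShift' d L mv kk r hL) μ x))ᴴ)) ((u' k x * U' μ x * (u' k ((scShift' d L mv kk r hL) μ x))ᴴ))ᴴ)) μ x') i j| ≤ ((((L ^ r * L ^ kk : ℕ) : ℝ))⁻¹) ^ 2 * (@basisConst ι _ (Matrix m m ℂ) Matrix.frobeniusNormedAddCommGroup Matrix.frobeniusNormedSpace e * (2 * Real.sqrt (Fintype.card m)) * (Real.sqrt (Fintype.card m) * q)) := fun i j => by simpa only [Equiv.symm_apply_apply] using hE2' k μ ((scShift' d L mv kk r hL) μ x') ((hQf k x' hx').2.2 μ) i j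
    have h := rowSum_fgradMat_tCoefA_inl_le_at ((((L ^ r * L ^ kk : ℕ) : ℝ))⁻¹) (scShift' d L mv kk r hL) (fun μ x => coordMat e (ContinuousLinearMap.mulLeftRight ℝ (Matrix m m ℂ) ((u' k x * U' μ x * (u' k ((scShift' d L mv kk r hL) μ x))ᴴ)) ((u' k x * U' μ x * (u' k ((scShift' d L mv kk r hL) μ x))ᴴ))ᴴ)) hη' hS i
    rw [inv_inv] at h; exact h.trans hrQ
  have hDAb' : ∀ k μ x', scChi' d L mv kk r hL k x' ≠ 0 → ∀ i, ∑ j, |fgradMat (((L ^ r * L ^ kk : ℕ) : ℝ)) ((scShift' d L mv kk r hL) μ) (tCoefA ((((L ^ r * L ^ kk : ℕ) : ℝ))⁻¹) (gaugePair (scShift' d L mv kk r hL) (fun μ x => coordMat e (ContinuousLinearMap.mulLeftRight ℝ (Matrix m m ℂ) ((u' k x * U' μ x * (u' k ((scShift' d L mv kk r hL) μ x))ᴴ)) ((u' k x * U' μ x * (u' k ((scShift' d L mv kk r hL) μ x))ᴴ))ᴴ))) (Sum.inr μ)) x' i j| ≤ rV := fun k μ x' hx' i => by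
    have h := rowSum_fgradMat_tCoefA_inr_le_at ((((L ^ r * L ^ kk : ℕ) : ℝ))⁻¹) (scShift' d L mv kk r hL) (fun μ x => coordMat e (ContinuousLinearMap.mulLeftRight ℝ (Matrix m m ℂ) ((u' k x * U' μ x * (u' k ((scShift' d L mv kk r hL) μ x))ᴴ)) ((u' k x * U' μ x * (u' k ((scShift' d L mv kk r hL) μ x))ᴴ))ᴴ)) hη' (hE2' k μ x' (hQf k x' hx').1) i
    rw [inv_inv] at h; exact h.trans hrQ
  have hDAf : ∀ k μ x, scChi d L mv kk hL k x ≠ 0 → ∀ i, ∑ j, |fgradMat (((L ^ kk : ℕ) : ℝ)) ((scShift d L mv kk hL) μ) (tCoefA ((((L ^ kk : ℕ) : ℝ))⁻¹) (gaugePair (scShift d L mv kk hL) (fun μ x => coordMat e (ContinuousLinearMap.mulLeftRight ℝ (Matrix m m ℂ) ((u' k (kingSec (cvM d L mv kk hL) L kk r x) * U μ x * (u' k (kingSec (cvM d L mv kk hL) L kk r ((scShift d L mv kk hL) μ x)))ᴴ)) ((u' k (kingSec (cvM d L mv kk hL) L kk r x) * U μ x * (u' k (kingSec (cvM d L mv kk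 hL) L kk r ((scShift d L mv kk hL) μ x)))ᴴ))ᴴ))) (Sum.inl μ)) x i j| ≤ rV := fun k μ x hx i => by
    have hS : ∀ i j, |((fun μ x => coordMat e (ContinuousLinearMap.mulLeftRight ℝ (Matrix m m ℂ) ((u' k (kingSec (cvM d L mv kk hL) L kk r x) * U μ x * (u' k (kingSec (cvM d L mv kk hL) L kk r ((scShift d L mv kk hL) μ x)))ᴴ)) ((u' k (kingSec (cvM d L mv kk hL) L kk r x) * U μ x * (u' k (kingSec (cvM d L mv kk hL) L kk r ((scShift d L mv kk hL) μ x)))ᴴ))ᴴ)) μ ((scShift d L mv kk hL) μ x) - (fun μ x => coordMat e (ContinuousLinearMap.mulLeftRight ℝ (Matrix m m ℂ) ((u' k (kingSec (cvM d L mv kk hL) L kk r x) * U μ x * (u' k (kingSec (cvM d L mv kk hL) L kk r ((scShift d L mv kk hL) μ x)))ᴴ)) ((u' k (kingSec (cvM d L mv kk hL) L kk r x) * U μ x * (u' k (kingSec (cvM d L mv kk hL) L kk r ((scShift d L mv kk hL) μ x)))ᴴ))ᴴ)) μ x) i j| ≤ ((((L ^ kk : ℕ) : ℝ))⁻¹)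 ^ 2 * (@basisConst ι _ (Matrix m m ℂ) Matrix.frobeniusNormedAddCommGroup Matrix.frobeniusNormedSpace e * (2 * Real.sqrt (Fintype.card m)) * (Real.sqrt (Fintype.card m) * q)) := fun i j => by simpa only [Equiv.symm_apply_apply] using hE2 k μ ((scShift d L mv kk hL) μ x) ((hQc k x hx).2.2 μ) i j
    have h := rowSum_fgradMat_tCoefA_inl_le_at ((((L ^ kk : ℕ) : ℝ))⁻¹) (scShift d L mv kk hL) (fun μ x => coordMat e (ContinuousLinearMap.mulLeftRight ℝ (Matrix m m ℂ) ((u' k (kingSec (cvM d L mv kk hL) L kk r x) * U μ x * (u' k (kingSec (cvM d L mv kk hL) L kk r ((scShift d L mv kk hL) μ x)))ᴴ)) ((u' k (kingSec (cvM d L mv kk hL) L kk r x) * U μ x * (u' k (kingSec (cvM d L mv kk hL) L kk r ((scShift d L mv kk hL) μ x)))ᴴ))ᴴ)) hη hS i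
    rw [inv_inv] at h; exact h.trans hrQ
  have hDAb : ∀ k μ x, scChi d L mv kk hL k x ≠ 0 → ∀ i, ∑ j, |fgradMat (((L ^ kk : ℕ) : ℝ)) ((scShift d L mv kk hL) μ) (tCoefA ((((L ^ kk : ℕ) : ℝ))⁻¹) (gaugePair (scShift d L mv kk hL) (fun μ x => coordMat e (ContinuousLinearMap.mulLeftRight ℝ (Matrix m m ℂ) ((u' k (kingSec (cvM d L mv kk hL) L kk r x) * U μ x * (u' k (kingSec (cvM d L mv kk hL) L kk r ((scShift d L mv kk hL) μ x)))ᴴ)) ((u' k (kingSec (cvM d L mv kk hL) L kk r x) * U μ x * (u' k (kingSec (cvM d L mv kk hL) L kk r ((scShift d L mv kk hL) μ x)))ᴴ))ᴴ))) (Sum.inr μ)) x i j| ≤ rV := fun k μ x hx i => by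
    have h := rowSum_fgradMat_tCoefA_inr_le_at ((((L ^ kk : ℕ) : ℝ))⁻¹) (scShift d L mv kk hL) (fun μ x => coordMat e (ContinuousLinearMap.mulLeftRight ℝ (Matrix m m ℂ) ((u' k (kingSec (cvM d L mv kk hL) L kk r x) * U μ x * (u' k (kingSec (cvM d L mv kk hL) L kk r ((scShift d L mv kk hL) μ x)))ᴴ)) ((u' k (kingSec (cvM d L mv kk hL) L kk r x) * U μ x * (u' k (kingSec (cvM d L mv kk hL) L kk r ((scShift d L mv kk hL) μ x)))ᴴ))ᴴ)) hη (hE2 k μ x (hQc k x hx).1) i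
    rw [inv_inv] at h; exact h.trans hrQ
  -- the cut rows of `N_V`, `N′_V`; the adjoint far rows and their defect VANISH (n15-c∕430a)
  have hNVcut : ∀ k, HasMaj (ScNorm d L mv kk hL ι) (ScNorm d L mv kk hL ι) (mulOp (fun p : ScX d L mv kk hL × ι => scPsi d L mv kk hL k p.1) ∘ₗ (scNV d L mv kk hL (aK a₀ (L : ℝ) kk * (((L ^ kk : ℕ) : ℝ)) ^ (d + 1)) ι e (fun k x => u' k (kingSec (cvM d L mv kk hL) L kk r x)) U) k ∘ₗ mulOp (fun p : ScX d L mv kk hL × ι => scChi d L mv kk hL k p.1)) (fun y y' => (a₀ * (Fintype.card ι * (Fintype.card ι * ((1 + rV * ((((L ^ kk : ℕ) : ℝ))⁻¹)) ^ ((d + 1) * L ^ kk) - 1) ^ 2 + 2 * ((1 + rV * ((((L ^ kk : ℕ) : ℝ))⁻¹)) ^ ((d + 1) * L ^ kk) - 1))) + a₀ * (Fintype.card ι * (Fintype.card ι * ((1 + rV * ((((L ^ r * L ^ kk : ℕ) : ℝ))⁻¹)) ^ ((d + 1) * (L ^ r * L ^ kk)) - 1) ^ 2 + 2 * ((1 +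 rV * ((((L ^ r * L ^ kk : ℕ) : ℝ))⁻¹)) ^ ((d + 1) * (L ^ r * L ^ kk)) - 1)))) * Real.exp (-(δ * (unitTorusGeo L kk (cvM d L mv kk hL)).dist y y'))) := fun k =>
    (hasMaj_scNV_cut_of_rows ι e he (aK a₀ (L : ℝ) kk * (((L ^ kk : ℕ) : ℝ)) ^ (d + 1)) hW U hrV k (fun μ x hx i => hAloc k (Sum.inl μ) x hx i) δ).mono fun y y' =>
      mul_le_mul_of_nonneg_right (by rw [habs]; nlinarith [mul_le_mul_of_nonneg_right haKle hSc0, mul_nonneg ha₀.le hSf0]) (Real.exp_nonneg _)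
  have hNVcut' : ∀ k, HasMaj (BlockNorm.ofBlocks (unitTorusGeo L kk (cvM d L mv kk hL)) (liftBlk (scBlk d L mv kk hL ∘ kingPr L kk r (cvM d L mv kk hL)) ι)) (BlockNorm.ofBlocks (unitTorusGeo L kk (cvM d L mv kk hL)) (liftBlk (scBlk d L mv kk hL ∘ kingPr L kk r (cvM d L mv kk hL)) ι)) (mulOp (fun p : ScX' d L mv kk r hL × ι => scPsi' d L mv kk r hL k p.1) ∘ₗ (scNV' d L mv kk r hL (aK a₀ (L : ℝ) (r + kk) * (((L ^ r * L ^ kk : ℕ) : ℝ)) ^ (d + 1)) ι e u' U') k ∘ₗ mulOp (fun p : ScX' d L mv kk r hL × ι => scChi' d L mv kk r hL k p.1)) (fun y y' => (a₀ * (Fintype.card ι * (Fintype.card ι * ((1 + rV * ((((L ^ kk : ℕ) : ℝ))⁻¹)) ^ ((d + 1) * L ^ kk) - 1) ^ 2 + 2 * ((1 + rV * ((((L ^ kk : ℕ) : ℝ))⁻¹)) ^ ((d + 1) * L ^ kk) - 1))) + a₀ * (Fintype.card ι * (Fintype.card ι * ((1 + rV * ((((L ^ r * L ^ kk : ℕ)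 : ℝ))⁻¹)) ^ ((d + 1) * (L ^ r * L ^ kk)) - 1) ^ 2 + 2 * ((1 + rV * ((((L ^ r * L ^ kk : ℕ) : ℝ))⁻¹)) ^ ((d + 1) * (L ^ r * L ^ kk)) - 1)))) * Real.exp (-(δ * (unitTorusGeo L kk (cvM d L mv kk hL)).dist y y'))) := fun k =>
    hasMaj_src_tgt_congr (funext fun p => (blockOf_kingPr (cvM d L mv kk hL) L kk r p.1).symm) ((hasMaj_scNV'_cut_of_rows ι e he (aK a₀ (L : ℝ) (r + kk) * (((L ^ r * L ^ kk : ℕ) : ℝ)) ^ (d + 1)) hu' U' hrV k (fun μ x hx i => hAloc' k (Sum.inl μ) x hx i) δ).mono fun y y' =>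
      mul_le_mul_of_nonneg_right (by rw [habs']; nlinarith [mul_le_mul_of_nonneg_right haKle' hSf0, mul_nonneg ha₀.le hSc0]) (Real.exp_nonneg _))
  have hfarN : ∀ k, HasMaj (ScNorm d L mv kk hL ι) (ScNorm d L mv kk hL ι) (mulOp (fun p : ScX d L mv kk hL × ι => scH d L mv kk hL k p.1) ∘ₗ (scNV d L mv kk hL (aK a₀ (L : ℝ) kk * (((L ^ kk : ℕ) : ℝ)) ^ (d + 1)) ι e (fun k x => u' k (kingSec (cvM d L mv kk hL) L kk r x)) U) k ∘ₗ (LinearMap.id - mulOp (fun p : ScX d L mv kk hL × ι => scBump d L mv kk hL k p.1))) (fun y y' => (0 : ℝ) * Real.exp (-(δ * (unitTorusGeo L kk (cvM d L mv kk hL)).dist y y'))) := fun k => by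
    rw [mulOp_scH_comp_scNV_comp_one_sub_scBump ι e he hw (aK a₀ (L : ℝ) kk * (((L ^ kk : ℕ) : ℝ)) ^ (d + 1)) hW U k]; exact (hasMaj_zero _ _).mono fun y y' => by rw [zero_mul]
  have hfarN' : ∀ k, HasMaj (BlockNorm.ofBlocks (unitTorusGeo L kk (cvM d L mv kk hL)) (liftBlk (scBlk d L mv kk hL ∘ kingPr L kk r (cvM d L mv kk hL)) ι)) (BlockNorm.ofBlocks (unitTorusGeo L kk (cvM d L mv kk hL)) (liftBlk (scBlk d L mv kk hL ∘ kingPr L kk r (cvM d L mv kk hL)) ι)) (mulOp (fun p : ScX' d L mv kk r hL × ι => scH' d L mv kk r hL k p.1) ∘ₗ (scNV' d L mv kk r hL (aK a₀ (L : ℝ) (r + kk) * (((L ^ r * L ^ kk : ℕ) : ℝ)) ^ (d + 1)) ι e u' U') k ∘ₗ (LinearMap.id - mulOp (fun p : ScX' d L mv kk r hL × ι => scBump' d L mv kk r hL k p.1))) (fun y y' => (0 : ℝ) * Real.exp (-(δ * (unitTorusGeo L kk (cvM d L mv kk hL)).dist y y'))) := fun k => by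
    rw [mulOp_scH'_comp_scNV'_comp_one_sub_scBump' ι e he hw (aK a₀ (L : ℝ) (r + kk) * (((L ^ r * L ^ kk : ℕ) : ℝ)) ^ (d + 1)) hu' U' k]; exact (hasMaj_zero _ _).mono fun y y' => by rw [zero_mul]
  have hDfarNa : ∀ k, HasMaj (ScNorm d L mv kk hL ι) (BlockNorm.ofBlocks (unitTorusGeo L kk (cvM d L mv kk hL)) (liftBlk (scBlk d L mv kk hL ∘ kingPr L kk r (cvM d L mv kk hL)) ι)) (idef (pull (liftMap (kingPr L kk r (cvM d L mv kk hL)) ι)) (pull (liftMap (kingPr L kk r (cvM d L mv kk hL)) ι)) (mulOp (fun p : ScX' d L mv kk r hL × ι => scH' d L mv kk r hL k p.1) ∘ₗ (scNV' d L mv kk r hL (aK a₀ (L : ℝ) (r + kk) * (((L ^ r * L ^ kk : ℕ) : ℝ)) ^ (d + 1)) ι e u' U') k ∘ₗ (LinearMap.id - mulOp (fun p : ScX' d L mv kk r hL × ι => scBump' d L mv kk r hL k p.1))) (mulOp (fun p : ScX d L mv kk hL × ι => scH d L mv kk hL k p.1) ∘ₗ (scNV d L mv kk hL (aK a₀ (L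 : ℝ) kk * (((L ^ kk : ℕ) : ℝ)) ^ (d + 1)) ι e (fun k x => u' k (kingSec (cvM d L mv kk hL) L kk r x)) U) k ∘ₗ (LinearMap.id - mulOp (fun p : ScX d L mv kk hL × ι => scBump d L mv kk hL k p.1)))) (fun y y' => (0 : ℝ) * Real.exp (-(δ * (unitTorusGeo L kk (cvM d L mv kk hL)).dist y y'))) := fun k => by
    rw [mulOp_scH_comp_scNV_comp_one_sub_scBump ι e he hw (aK a₀ (L : ℝ) kk * (((L ^ kk : ℕ) : ℝ)) ^ (d + 1)) hW U k, mulOp_scH'_comp_scNV'_comp_one_sub_scBump' ι e he hw (aK a₀ (L : ℝ) (r + kk) * (((L ^ r * L ^ kk : ℕ) : ℝ)) ^ (d + 1)) hu' U' k, idef_zero]; exact (hasMaj_zero _ _).mono fun y y' => by rw [zero_mul]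
  -- the right factors `E := D*_{U,ν}`, `E_f := D*_{U′,ν}`: gauges, covariant shapes and Leibniz rules (n15-c∕284), rows (n15-c∕285)
  have hug : ∀ k x, (fun x => coordMat e (ContinuousLinearMap.mulLeftRight ℝ (Matrix m m ℂ) (u' k (kingSec (cvM d L mv kk hL) L kk r x)) (u' k (kingSec (cvM d L mv kk hL) L kk r x))ᴴ)) x * ((fun x => coordMat e (ContinuousLinearMap.mulLeftRight ℝ (Matrix m m ℂ) (u' k (kingSec (cvM d L mv kk hL) L kk r x)) (u' k (kingSec (cvM d L mv kk hL) L kk r x))ᴴ)) x)ᵀ = 1 := fun k x => (uN_siteGauge_orthogonal e (fun x => u' k (kingSec (cvM d L mv kk hL) L kk r x)) he (fun x => hu' k _) x).1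
  have hug' : ∀ k x, ((fun x => coordMat e (ContinuousLinearMap.mulLeftRight ℝ (Matrix m m ℂ) (u' k (kingSec (cvM d L mv kk hL) L kk r x)) (u' k (kingSec (cvM d L mv kk hL) L kk r x))ᴴ)) x)ᵀ * (fun x => coordMat e (ContinuousLinearMap.mulLeftRight ℝ (Matrix m m ℂ) (u' k (kingSec (cvM d L mv kk hL) L kk r x)) (u' k (kingSec (cvM d L mv kk hL) L kk r x))ᴴ)) x = 1 := fun k x => (uN_siteGauge_orthogonal e (fun x => u' k (kingSec (cvM d L mv kk hL) L kk r x)) he (fun x => hu' k _) x).2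
  have hugf : ∀ k x, (fun x => coordMat e (ContinuousLinearMap.mulLeftRight ℝ (Matrix m m ℂ) (u' k x) (u' k x)ᴴ)) x * ((fun x => coordMat e (ContinuousLinearMap.mulLeftRight ℝ (Matrix m m ℂ) (u' k x) (u' k x)ᴴ)) x)ᵀ = 1 := fun k x => (uN_siteGauge_orthogonal e (u' k) he (hu' k) x).1
  have hugf' : ∀ k x, ((fun x => coordMat e (ContinuousLinearMap.mulLeftRight ℝ (Matrix m m ℂ) (u' k x) (u' k x)ᴴ)) x)ᵀ * (fun x => coordMat e (ContinuousLinearMap.mulLeftRight ℝ (Matrix m m ℂ) (u' k x) (u' k x)ᴴ)) x = 1 := fun k x => (uN_siteGauge_orthogonal e (u' k) he (hu' k) x).2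
  have hWS : ∀ k ν y, (fun x => coordMat e (ContinuousLinearMap.mulLeftRight ℝ (Matrix m m ℂ) (u' k (kingSec (cvM d L mv kk hL) L kk r x)) (u' k (kingSec (cvM d L mv kk hL) L kk r x))ᴴ)) y * (cvT e U) ν y * ((fun x => coordMat e (ContinuousLinearMap.mulLeftRight ℝ (Matrix m m ℂ) (u' k (kingSec (cvM d L mv kk hL) L kk r x)) (u' k (kingSec (cvM d L mv kk hL) L kk r x))ᴴ)) ((scShift d L mv kk hL) ν y))ᵀ = (fun μ x => coordMat e (ContinuousLinearMap.mulLeftRight ℝ (Matrix m m ℂ) ((u' k (kingSec (cvM d L mv kk hL) L kk r x) * U μ x * (u' k (kingSec (cvM d L mv kk hL) L kk r ((scShift d L mv kk hL) μ x)))ᴴ)) ((u' k (kingSec (cvM d L mv kk hL) L kk r x) * U μ x * (u' k (kingSec (cvM d L mv kk hL) L kk r ((scShift d L mv kk hL) μ x)))ᴴ))ᴴ)) ν y := fun k ν y => uN_conj_coordMat_eq e (scShift d L mv kk hL) he (fun x => hu' k _) U ν y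
  have hWSf : ∀ k ν y, (fun x => coordMat e (ContinuousLinearMap.mulLeftRight ℝ (Matrix m m ℂ) (u' k x) (u' k x)ᴴ)) y * (cvT e U') ν y * ((fun x => coordMat e (ContinuousLinearMap.mulLeftRight ℝ (Matrix m m ℂ) (u' k x) (u' k x)ᴴ)) ((scShift' d L mv kk r hL) ν y))ᵀ = (fun μ x => coordMat e (ContinuousLinearMap.mulLeftRight ℝ (Matrix m m ℂ) ((u' k x * U' μ x * (u' k ((scShift' d L mv kk r hL) μ x))ᴴ)) ((u' k x * U' μ x * (u' k ((scShift' d L mv kk r hL) μ x))ᴴ))ᴴ)) ν y := fun k ν y => uN_conj_coordMat_eq e (scShift' d L mv kk r hL) he (hu' k) U' ν y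
  have hleib : ∀ k, mulOp (fun p : ScX d L mv kk hL × ι => scH d L mv kk hL k p.1) ∘ₗ (covD ((((L ^ kk : ℕ) : ℝ))⁻¹) (fun y => ((cvT e U) ν (((scShift d L mv kk hL) ν).symm y))ᵀ) ⇑((scShift d L mv kk hL) ν).symm) = (covD ((((L ^ kk : ℕ) : ℝ))⁻¹) (fun y => ((cvT e U) ν (((scShift d L mv kk hL) ν).symm y))ᵀ) ⇑((scShift d L mv kk hL) ν).symm) ∘ₗ mulOp (fun p : ScX d L mv kk hL × ι => scH d L mv kk hL k ((scShift d L mv kk hL) ν p.1)) + mulOp (fun p : ScX d L mv kk hL × ι => (fun k x => fgrad ((((L ^ kk : ℕ) : ℝ))⁻¹)⁻¹ ((scShift d L mv kk hL) ν) (scH d L mv kk hL k) x) k p.1) := fun k =>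
    mulOp_comp_covD_symm ((((L ^ kk : ℕ) : ℝ))⁻¹) (fun y => ((cvT e U) ν (((scShift d L mv kk hL) ν).symm y))ᵀ) ((scShift d L mv kk hL) ν) (scH d L mv kk hL k)
  have hleib' : ∀ k, mulOp (fun p : ScX' d L mv kk r hL × ι => scH' d L mv kk r hL k p.1) ∘ₗ (covD ((((L ^ r * L ^ kk : ℕ) : ℝ))⁻¹) (fun y => ((cvT e U') ν (((scShift' d L mv kk r hL) ν).symm y))ᵀ) ⇑((scShift' d L mv kk r hL) ν).symm) = (covD ((((L ^ r * L ^ kk : ℕ) : ℝ))⁻¹) (fun y => ((cvT e U') ν (((scShift' d L mv kk r hL) ν).symm y))ᵀ) ⇑((scShift' d L mv kk r hL) ν).symm) ∘ₗ mulOp (fun p : ScX' d L mv kk r hL × ι => scH' d L mv kk r hL k ((scShift' d L mv kk r hL) ν p.1)) + mulOp (fun p : ScX' d L mv kk r hL × ι => (fun k x => fgrad ((((L ^ r * L ^ kk : ℕ) : ℝ))⁻¹)⁻¹ ((scShift' d L mv kk r hL) ν) (scH' d L mv kk r hL k) x) k p.1) := fun k =>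
    mulOp_comp_covD_symm ((((L ^ r * L ^ kk : ℕ) : ℝ))⁻¹) (fun y => ((cvT e U') ν (((scShift' d L mv kk r hL) ν).symm y))ᵀ) ((scShift' d L mv kk r hL) ν) (scH' d L mv kk r hL k)
  have hξ0 : ∀ μ ν (x : ScX d L mv kk hL), ∃ z : ℤ, scXi d L mv kk hL ν (scShift d L mv kk hL μ x) = scXi d L mv kk hL ν x + (if ν = μ then ((((L ^ kk : ℕ) : ℝ)) * ((L ^ mv : ℕ) : ℝ))⁻¹ else 0) + (z : ℝ) * ((2 * L : ℕ) : ℝ) :=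
    fun μ ν x => coverXi_shift (n := L ^ kk) (q := L) hM hw μ ν (x, 0)
  have hξ0' : ∀ μ ν (x : ScX' d L mv kk r hL), ∃ z : ℤ, scXi' d L mv kk r hL ν (scShift' d L mv kk r hL μ x) = scXi' d L mv kk r hL ν x + (if ν = μ then ((((L ^ r * L ^ kk : ℕ) : ℝ)) * ((L ^ mv : ℕ) : ℝ))⁻¹ else 0) + (z : ℝ) * ((2 * L : ℕ) : ℝ) :=
    fun μ ν x => coverXi_shift (n := L ^ r * L ^ kk) (q := L) hM hw μ ν (x, 0)
  have hsW : |((((L ^ kk : ℕ) : ℝ))⁻¹)⁻¹| * (π * |((((L ^ kk : ℕ) : ℝ)) * ((L ^ mv : ℕ) : ℝ))⁻¹|) = π / ((L ^ mv : ℕ) : ℝ) := by rw [inv_inv, abs_of_pos hnr, abs_of_nonneg (by positivity), mul_inv]; field_simp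
  have hsW' : |((((L ^ r * L ^ kk : ℕ) : ℝ))⁻¹)⁻¹| * (π * |((((L ^ r * L ^ kk : ℕ) : ℝ)) * ((L ^ mv : ℕ) : ℝ))⁻¹|) = π / ((L ^ mv : ℕ) : ℝ) := by rw [inv_inv, abs_of_pos hnr', abs_of_nonneg (by positivity), mul_inv]; field_simp
  have hdh : ∀ k x, |(fun k x => fgrad ((((L ^ kk : ℕ) : ℝ))⁻¹)⁻¹ ((scShift d L mv kk hL) ν) (scH d L mv kk hL k) x) k x| ≤ (π / ((L ^ mv : ℕ) : ℝ)) := fun k x => (abs_fgrad_hcube_le (2 * L) (scXi d L mv kk hL) (scShift d L mv kk hL) hK0 hξ0 _ k ν x).trans hsW.le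
  have hdh' : ∀ k x, |(fun k x => fgrad ((((L ^ r * L ^ kk : ℕ) : ℝ))⁻¹)⁻¹ ((scShift' d L mv kk r hL) ν) (scH' d L mv kk r hL k) x) k x| ≤ (π / ((L ^ mv : ℕ) : ℝ)) := fun k x => (abs_fgrad_hcube_le (2 * L) (scXi' d L mv kk r hL) (scShift' d L mv kk r hL) hK0 hξ0' _ k ν x).trans hsW'.le
  have hEcov : ∀ k, mmulOp (fun x => coordMat e (ContinuousLinearMap.mulLeftRight ℝ (Matrix m m ℂ) (u' k (kingSec (cvM d L mv kk hL) L kk r x)) (u' k (kingSec (cvM d L mv kk hL) L kk r x))ᴴ)) ∘ₗ (covD ((((L ^ kk : ℕ) : ℝ))⁻¹) (fun y => ((cvT e U) ν (((scShift d L mv kk hL) ν).symm y))ᵀ) ⇑((scShift d L mv kk hL) ν).symm) ∘ₗ mmulOp (fun x => ((fun x => coordMat e (ContinuousLinearMap.mulLeftRight ℝ (Matrix m m ℂ) (u' k (kingSec (cvM d L mv kk hL) L kk r x)) (u' k (kingSec (cvM d L mv kk hL) L kk r x))ᴴ)) x)ᵀ) = mmulOp ((fun k y => -((fun x => coordMat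 e (ContinuousLinearMap.mulLeftRight ℝ (Matrix m m ℂ) (u' k (kingSec (cvM d L mv kk hL) L kk r x)) (u' k (kingSec (cvM d L mv kk hL) L kk r x))ᴴ)) y * ((cvT e U) ν (((scShift d L mv kk hL) ν).symm y))ᵀ * ((fun x => coordMat e (ContinuousLinearMap.mulLeftRight ℝ (Matrix m m ℂ) (u' k (kingSec (cvM d L mv kk hL) L kk r x)) (u' k (kingSec (cvM d L mv kk hL) L kk r x))ᴴ)) (((scShift d L mv kk hL) ν).symm y))ᵀ)) k) ∘ₗ bgrad (((L ^ kk : ℕ) : ℝ)) (liftEquiv ((scShift d L mv kk hL) ν) ι) + mmulOp ((fun k y => (((L ^ kk : ℕ) : ℝ)) • ((fun x => coordMat e (ContinuousLinearMap.mulLeftRight ℝ (Matrix m m ℂ) (u' k (kingSec (cvM d L mv kk hL) L kk r x)) (u' k (kingSec (cvM d L mv kk hL) L kk r x))ᴴ)) y * ((cvT e U) ν (((scShift d L mv kk hL) ν).symm y))ᵀ * ((fun x => coordMat e (ContinuousLinearMap.mulLeftRight ℝ (Matrix m m ℂ) (u' k (kingSec (cvM d L mv kk hL) L kk r x)) (u'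 k (kingSec (cvM d L mv kk hL) L kk r x))ᴴ)) (((scShift d L mv kk hL) ν).symm y))ᵀ - 1)) k) := fun k => by
    have h := covD_symm_covShape (hug k) (hug' k) ((((L ^ kk : ℕ) : ℝ))⁻¹) (fun y => ((cvT e U) ν (((scShift d L mv kk hL) ν).symm y))ᵀ) ((scShift d L mv kk hL) ν)
    rw [inv_inv] at h; exact h
  have hEcovf : ∀ k, mmulOp (fun x => coordMat e (ContinuousLinearMap.mulLeftRight ℝ (Matrix m m ℂ) (u' k x) (u' k x)ᴴ)) ∘ₗ (covD ((((L ^ r * L ^ kk : ℕ) : ℝ))⁻¹) (fun y => ((cvT e U') ν (((scShift' d L mv kk r hL) ν).symm y))ᵀ) ⇑((scShift' d L mv kk r hL) ν).symm) ∘ₗ mmulOp (fun x => ((fun x => coordMat e (ContinuousLinearMap.mulLeftRight ℝ (Matrix m m ℂ) (u' k x) (u' k x)ᴴ)) x)ᵀ) = mmulOp ((fun k y => -((fun x => coordMat e (ContinuousLinearMap.mulLeftRight ℝ (Matrix m m ℂ) (u' k x) (u' k x)ᴴ)) y * ((cvT e U') ν (((scShift' d L mv kk r hL) ν).symm y))ᵀ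 * ((fun x => coordMat e (ContinuousLinearMap.mulLeftRight ℝ (Matrix m m ℂ) (u' k x) (u' k x)ᴴ)) (((scShift' d L mv kk r hL) ν).symm y))ᵀ)) k) ∘ₗ bgrad (((L ^ r * L ^ kk : ℕ) : ℝ)) (liftEquiv ((scShift' d L mv kk r hL) ν) ι) + mmulOp ((fun k y => (((L ^ r * L ^ kk : ℕ) : ℝ)) • ((fun x => coordMat e (ContinuousLinearMap.mulLeftRight ℝ (Matrix m m ℂ) (u' k x) (u' k x)ᴴ)) y * ((cvT e U') ν (((scShift' d L mv kk r hL) ν).symm y))ᵀ * ((fun x => coordMat e (ContinuousLinearMap.mulLeftRight ℝ (Matrix m m ℂ) (u' k x) (u' k x)ᴴ)) (((scShift' d L mv kk r hL) ν).symm y))ᵀ - 1)) k) := fun k => by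
    have h := covD_symm_covShape (hugf k) (hugf' k) ((((L ^ r * L ^ kk : ℕ) : ℝ))⁻¹) (fun y => ((cvT e U') ν (((scShift' d L mv kk r hL) ν).symm y))ᵀ) ((scShift' d L mv kk r hL) ν)
    rw [inv_inv] at h; exact h
  have hRE : ∀ k x, scChi d L mv kk hL k x ≠ 0 → ∀ i, ∑ j, |(((fun k y => -((fun x => coordMat e (ContinuousLinearMap.mulLeftRight ℝ (Matrix m m ℂ) (u' k (kingSec (cvM d L mv kk hL) L kk r x)) (u' k (kingSec (cvM d L mv kk hL) L kk r x))ᴴ)) y * ((cvT e U) ν (((scShift d L mv kk hL) ν).symm y))ᵀ * ((fun x => coordMat e (ContinuousLinearMap.mulLeftRight ℝ (Matrix m m ℂ) (u' k (kingSec (cvM d L mv kk hL) L kk r x)) (u' k (kingSec (cvM d L mv kk hL) L kk r x))ᴴ)) (((scShift d L mv kk hL) ν).symm y))ᵀ)) k) ∘ ⇑((scShift d L mv kk hL) ν)) x i j| ≤ 1 + rV := fun k x hx i =>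
    (rowSum_neg_conj_shift_le_at ((((L ^ kk : ℕ) : ℝ))⁻¹) (scShift d L mv kk hL) (fun μ x => coordMat e (ContinuousLinearMap.mulLeftRight ℝ (Matrix m m ℂ) ((u' k (kingSec (cvM d L mv kk hL) L kk r x) * U μ x * (u' k (kingSec (cvM d L mv kk hL) L kk r ((scShift d L mv kk hL) μ x)))ᴴ)) ((u' k (kingSec (cvM d L mv kk hL) L kk r x) * U μ x * (u' k (kingSec (cvM d L mv kk hL) L kk r ((scShift d L mv kk hL) μ x)))ᴴ))ᴴ)) (hWS k) (hE1 k ν x (hQc k x hx).1) i).trans (by nlinarith [hP10, hηle, hη.le, hrA, (Nat.cast_nonneg (Fintype.card ι) : (0 : ℝ) ≤ _)])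
  have hREf : ∀ k x, scChi' d L mv kk r hL k x ≠ 0 → ∀ i, ∑ j, |(((fun k y => -((fun x => coordMat e (ContinuousLinearMap.mulLeftRight ℝ (Matrix m m ℂ) (u' k x) (u' k x)ᴴ)) y * ((cvT e U') ν (((scShift' d L mv kk r hL) ν).symm y))ᵀ * ((fun x => coordMat e (ContinuousLinearMap.mulLeftRight ℝ (Matrix m m ℂ) (u' k x) (u' k x)ᴴ)) (((scShift' d L mv kk r hL) ν).symm y))ᵀ)) k) ∘ ⇑((scShift' d L mv kk r hL) ν)) x i j| ≤ 1 + rV := fun k x hx i =>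
    (rowSum_neg_conj_shift_le_at ((((L ^ r * L ^ kk : ℕ) : ℝ))⁻¹) (scShift' d L mv kk r hL) (fun μ x => coordMat e (ContinuousLinearMap.mulLeftRight ℝ (Matrix m m ℂ) ((u' k x * U' μ x * (u' k ((scShift' d L mv kk r hL) μ x))ᴴ)) ((u' k x * U' μ x * (u' k ((scShift' d L mv kk r hL) μ x))ᴴ))ᴴ)) (hWSf k) (hE1' k ν x (hQf k x hx).1) i).trans (by nlinarith [hP10, hη'le, hη'.le, hrA, (Nat.cast_nonneg (Fintype.card ι) : (0 : ℝ) ≤ _)])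
  have hRE' : ∀ k x, scChi d L mv kk hL k x ≠ 0 → ∀ i, ∑ j, |(fgradMat (((L ^ kk : ℕ) : ℝ)) ((scShift d L mv kk hL) ν) ((fun k y => -((fun x => coordMat e (ContinuousLinearMap.mulLeftRight ℝ (Matrix m m ℂ) (u' k (kingSec (cvM d L mv kk hL) L kk r x)) (u' k (kingSec (cvM d L mv kk hL) L kk r x))ᴴ)) y * ((cvT e U) ν (((scShift d L mv kk hL) ν).symm y))ᵀ * ((fun x => coordMat e (ContinuousLinearMap.mulLeftRight ℝ (Matrix m m ℂ) (u' k (kingSec (cvM d L mv kk hL) L kk r x)) (u' k (kingSec (cvM d L mv kk hL) L kk r x))ᴴ)) (((scShift d L mv kk hL) ν).symm y))ᵀ)) k)) x i j| ≤ rV := fun k x hx i => by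
    have h := rowSum_fgradMat_neg_conj_le_at ((((L ^ kk : ℕ) : ℝ))⁻¹) (scShift d L mv kk hL) (fun μ x => coordMat e (ContinuousLinearMap.mulLeftRight ℝ (Matrix m m ℂ) ((u' k (kingSec (cvM d L mv kk hL) L kk r x) * U μ x * (u' k (kingSec (cvM d L mv kk hL) L kk r ((scShift d L mv kk hL) μ x)))ᴴ)) ((u' k (kingSec (cvM d L mv kk hL) L kk r x) * U μ x * (u' k (kingSec (cvM d L mv kk hL) L kk r ((scShift d L mv kk hL) μ x)))ᴴ))ᴴ)) (hWS k) hη (hE2 k ν x (hQc k x hx).1) i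
    rw [inv_inv] at h; exact h.trans hqι
  have hREf' : ∀ k x, scChi' d L mv kk r hL k x ≠ 0 → ∀ i, ∑ j, |(fgradMat (((L ^ r * L ^ kk : ℕ) : ℝ)) ((scShift' d L mv kk r hL) ν) ((fun k y => -((fun x => coordMat e (ContinuousLinearMap.mulLeftRight ℝ (Matrix m m ℂ) (u' k x) (u' k x)ᴴ)) y * ((cvT e U') ν (((scShift' d L mv kk r hL) ν).symm y))ᵀ * ((fun x => coordMat e (ContinuousLinearMap.mulLeftRight ℝ (Matrix m m ℂ) (u' k x) (u' k x)ᴴ)) (((scShift' d L mv kk r hL) ν).symm y))ᵀ)) k)) x i j| ≤ rV := fun k x hx i => by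
    have h := rowSum_fgradMat_neg_conj_le_at ((((L ^ r * L ^ kk : ℕ) : ℝ))⁻¹) (scShift' d L mv kk r hL) (fun μ x => coordMat e (ContinuousLinearMap.mulLeftRight ℝ (Matrix m m ℂ) ((u' k x * U' μ x * (u' k ((scShift' d L mv kk r hL) μ x))ᴴ)) ((u' k x * U' μ x * (u' k ((scShift' d L mv kk r hL) μ x))ᴴ))ᴴ)) (hWSf k) hη' (hE2' k ν x (hQf k x hx).1) i
    rw [inv_inv] at h; exact h.trans hqι'
  have hBE : ∀ k x, scChi d L mv kk hL k x ≠ 0 → ∀ i, ∑ j, |((fun k y => (((L ^ kk : ℕ) : ℝ)) • ((fun x => coordMat e (ContinuousLinearMap.mulLeftRight ℝ (Matrix m m ℂ) (u' k (kingSec (cvM d L mv kk hL) L kk r x)) (u' k (kingSec (cvM d L mv kk hL) L kk r x))ᴴ)) y * ((cvT e U) ν (((scShift d L mv kk hL) ν).symm y))ᵀ * ((fun x => coordMat e (ContinuousLinearMap.mulLeftRight ℝ (Matrix m m ℂ) (u' k (kingSec (cvM d L mv kk hL) L kk r x)) (u' k (kingSec (cvM d L mv kk hL) L kk r x))ᴴ))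 (((scShift d L mv kk hL) ν).symm y))ᵀ - 1)) k) x i j| ≤ rV := fun k x hx i => by
    have h := rowSum_smul_conj_sub_one_le_at ((((L ^ kk : ℕ) : ℝ))⁻¹) (scShift d L mv kk hL) (fun μ x => coordMat e (ContinuousLinearMap.mulLeftRight ℝ (Matrix m m ℂ) ((u' k (kingSec (cvM d L mv kk hL) L kk r x) * U μ x * (u' k (kingSec (cvM d L mv kk hL) L kk r ((scShift d L mv kk hL) μ x)))ᴴ)) ((u' k (kingSec (cvM d L mv kk hL) L kk r x) * U μ x * (u' k (kingSec (cvM d L mv kk hL) L kk r ((scShift d L mv kk hL) μ x)))ᴴ))ᴴ)) (hWS k) hη (hE1 k ν _ ((hQc k x hx).2.1 ν)) i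
    rw [inv_inv] at h; exact h.trans hrA
  have hBEf : ∀ k x, scChi' d L mv kk r hL k x ≠ 0 → ∀ i, ∑ j, |((fun k y => (((L ^ r * L ^ kk : ℕ) : ℝ)) • ((fun x => coordMat e (ContinuousLinearMap.mulLeftRight ℝ (Matrix m m ℂ) (u' k x) (u' k x)ᴴ)) y * ((cvT e U') ν (((scShift' d L mv kk r hL) ν).symm y))ᵀ * ((fun x => coordMat e (ContinuousLinearMap.mulLeftRight ℝ (Matrix m m ℂ) (u' k x) (u' k x)ᴴ)) (((scShift' d L mv kk r hL) ν).symm y))ᵀ - 1)) k) x i j| ≤ rV := fun k x hx i => by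
    have h := rowSum_smul_conj_sub_one_le_at ((((L ^ r * L ^ kk : ℕ) : ℝ))⁻¹) (scShift' d L mv kk r hL) (fun μ x => coordMat e (ContinuousLinearMap.mulLeftRight ℝ (Matrix m m ℂ) ((u' k x * U' μ x * (u' k ((scShift' d L mv kk r hL) μ x))ᴴ)) ((u' k x * U' μ x * (u' k ((scShift' d L mv kk r hL) μ x))ᴴ))ᴴ)) (hWSf k) hη' (hE1' k ν _ ((hQf k x hx).2.1 ν)) i
    rw [inv_inv] at h; exact h.trans hrA
  -- the Leibniz remainders' two-grid fit (n15-c∕338b), the summand's right locality (n15-c∕430a), the column letter (414)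
  have h3 : 3 ≤ L ^ kk * L ^ mv := le_trans hW3 (Nat.le_mul_of_pos_left _ (pow_pos hLpos kk))
  have hfdh : ∀ k (x' : ScX' d L mv kk r hL), |(fun k x => fgrad ((((L ^ r * L ^ kk : ℕ) : ℝ))⁻¹)⁻¹ ((scShift' d L mv kk r hL) ν) (scH' d L mv kk r hL k) x) k x' - (fun k x => fgrad ((((L ^ kk : ℕ) : ℝ))⁻¹)⁻¹ ((scShift d L mv kk hL) ν) (scH d L mv kk hL k) x) k ((kingPr L kk r (cvM d L mv kk hL)) x')| ≤ (|(((L ^ mv : ℕ) : ℝ))⁻¹| * (((L ^ kk : ℕ) : ℝ) * ((L ^ mv : ℕ) : ℝ))⁻¹ * (64 * π ^ 2 + π ^ 2 * Fintype.card (Fin (d + 1)))) := fun k x' => by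
    simpa only [inv_inv, fgrad_apply, liftEquiv_apply, liftMap] using abs_fgrad_scH'_sub_le PUnit hM hw h3 k ν (x', PUnit.unit)
  have hhχ' : ∀ (k : (Fin (d + 1) → ZMod (2 * L))) (x : ScX' d L mv kk r hL), scH' d L mv kk r hL k x ≠ 0 → scChi' d L mv kk r hL k x ≠ 0 := fun k x hx => by
    have h := chiCube_box_eq_one_of_coverH_ne_zero (n := L ^ r * L ^ kk) hM hw hS6 0 k (x := (x, (0 : Fin (d + 1)))) (Or.inl rfl) hx
    rw [show scChi' d L mv kk r hL k x = chiCube (cvM d L mv kk hL) (L ^ r * L ^ kk) (coverCorner (cvM d L mv kk hL) (L ^ mv) L (2 * L ^ mv) k) (6 * L ^ mv + 1) (x, 0) from rfl, h]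
    exact one_ne_zero
  have hPloc' := fun k => mulOp_scH'_comp_scP'_comp_one_sub_scPsi' ι e hM hmg₂ hfg₂ hS0 (aK a₀ (L : ℝ) (r + kk) * (((L ^ r * L ^ kk : ℕ) : ℝ)) ^ (d + 1)) U' k (hhχ' k)
  have hρ : ∀ (k : (Fin (d + 1) → ZMod (2 * L))) (μ : Fin (d + 1)) (y' : ScX' d L mv kk r hL), scBlk' d L mv kk r hL y' ∈ cvSk d L mv kk hL k → ∀ j, ∑ i, |(coordMat e (ContinuousLinearMap.mulLeftRight ℝ (Matrix m m ℂ) (u' k y' * U' μ y' * (u' k (y' + unitVec (fine (L ^ r * L ^ kk) (cvM d L mv kk hL)) μ))ᴴ) (u' k y' * U' μ y' * (u' k (y' + unitVec (fine (L ^ r * L ^ kk) (cvM d L mv kk hL)) μ))ᴴ)ᴴ) - 1) i j| ≤ (Fintype.card ι * (((((L ^ r * L ^ kk : ℕ) : ℝ))⁻¹) * (@basisConst ι _ (Matrix m m ℂ) Matrix.frobeniusNormedAddCommGroup Matrix.frobeniusNormedSpace e * (2 * Real.sqrt (Fintype.card m)) * (Real.sqrt (Fintype.card m) * p)))) := fun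 k μ y' hy' j =>
    calc _ ≤ ∑ _i : ι, ((((L ^ r * L ^ kk : ℕ) : ℝ))⁻¹) * (@basisConst ι _ (Matrix m m ℂ) Matrix.frobeniusNormedAddCommGroup Matrix.frobeniusNormedSpace e * (2 * Real.sqrt (Fintype.card m)) * (Real.sqrt (Fintype.card m) * p)) := Finset.sum_le_sum fun i _ => hE1' k μ y' (hQρ k y' hy') i j
      _ = (Fintype.card ι * (((((L ^ r * L ^ kk : ℕ) : ℝ))⁻¹) * (@basisConst ι _ (Matrix m m ℂ) Matrix.frobeniusNormedAddCommGroup Matrix.frobeniusNormedSpace e * (2 * Real.sqrt (Fintype.card m)) * (Real.sqrt (Fintype.card m) * p)))) := by rw [Finset.sum_const, Finset.card_univ, nsmul_eq_mul]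
  -- the two-grid letters for the final kernel
  have hnR : (1 : ℝ) ≤ ((L ^ kk : ℕ) : ℝ) := hn1
  let εk : ℝ := ((L : ℝ) ^ kk) ^ (-(1 / 4 : ℝ)); have hLk1 : (1 : ℝ) ≤ (L : ℝ) ^ kk := (by rw [← Nat.cast_pow]; exact hnR); have hεk0 : 0 ≤ εk := Real.rpow_nonneg (by positivity) _
  have hnε : (((L ^ kk : ℕ) : ℝ))⁻¹ ≤ εk := by rw [Nat.cast_pow, ← Real.rpow_neg_one]; exact Real.rpow_le_rpow_of_exponent_le hLk1 (by norm_num)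
  have hw1 : (((L ^ mv : ℕ) : ℝ))⁻¹ ≤ 1 := inv_le_one_of_one_le₀ hW1
  have hnwε : ((((L ^ kk : ℕ) : ℝ)) * ((L ^ mv : ℕ) : ℝ))⁻¹ ≤ εk :=
    calc ((((L ^ kk : ℕ) : ℝ)) * ((L ^ mv : ℕ) : ℝ))⁻¹ = (((L ^ kk : ℕ) : ℝ))⁻¹ * (((L ^ mv : ℕ) : ℝ))⁻¹ := by rw [mul_inv]
      _ ≤ (((L ^ kk : ℕ) : ℝ))⁻¹ * 1 := mul_le_mul_of_nonneg_left hw1 (by positivity)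
      _ ≤ εk := by rw [mul_one]; exact hnε
  have hO10 : 0 ≤ (|(((L ^ mv : ℕ) : ℝ))⁻¹| * (((L ^ kk : ℕ) : ℝ) * ((L ^ mv : ℕ) : ℝ))⁻¹ * (64 * π ^ 2 + π ^ 2 * Fintype.card (Fin (d + 1)))) := by positivity
  have hO1ε : (|(((L ^ mv : ℕ) : ℝ))⁻¹| * (((L ^ kk : ℕ) : ℝ) * ((L ^ mv : ℕ) : ℝ))⁻¹ * (64 * π ^ 2 + π ^ 2 * Fintype.card (Fin (d + 1)))) ≤ (64 * π ^ 2 + π ^ 2 * Fintype.card (Fin (d + 1))) * εk := by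
    have hwabs : |(((L ^ mv : ℕ) : ℝ))⁻¹| ≤ 1 := by rw [abs_of_nonneg (inv_nonneg.mpr hWpos.le)]; exact hw1
    calc (|(((L ^ mv : ℕ) : ℝ))⁻¹| * (((L ^ kk : ℕ) : ℝ) * ((L ^ mv : ℕ) : ℝ))⁻¹ * (64 * π ^ 2 + π ^ 2 * Fintype.card (Fin (d + 1)))) ≤ 1 * εk * (64 * π ^ 2 + π ^ 2 * Fintype.card (Fin (d + 1))) := mul_le_mul_of_nonneg_right (mul_le_mul hwabs hnwε (inv_nonneg.mpr (mul_nonneg hnr.le hWpos.le)) zero_le_one) (by positivity)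
      _ = (64 * π ^ 2 + π ^ 2 * Fintype.card (Fin (d + 1))) * εk := by ring
  have hρv0 : 0 ≤ (Fintype.card ι * (((((L ^ r * L ^ kk : ℕ) : ℝ))⁻¹) * (@basisConst ι _ (Matrix m m ℂ) Matrix.frobeniusNormedAddCommGroup Matrix.frobeniusNormedSpace e * (2 * Real.sqrt (Fintype.card m)) * (Real.sqrt (Fintype.card m) * p)))) := by positivity
  have hsS0 : 0 ≤ (1 + (Fintype.card ι * (((((L ^ r * L ^ kk : ℕ) : ℝ))⁻¹) * (@basisConst ι _ (Matrix m m ℂ) Matrix.frobeniusNormedAddCommGroup Matrix.frobeniusNormedSpace e * (2 * Real.sqrt (Fintype.card m)) * (Real.sqrt (Fintype.card m) * p))))) ^ ((d + 1) * (L ^ r - 1)) - 1 := by have h1 := one_le_pow₀ (M₀ := ℝ) (a := 1 + (Fintype.card ι * (((((L ^ r * L ^ kk : ℕ) : ℝ))⁻¹) * (@basisConst ι _ (Matrix m m ℂ) Matrix.frobeniusNormedAddCommGroup Matrix.frobeniusNormedSpace e * (2 * Real.sqrt (Fintype.card m)) * (Real.sqrt (Fintype.card m) * p))))) (by linarith only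 [hρv0]) (n := (d + 1) * (L ^ r - 1)); linarith only [h1]
  have ho0 : 0 ≤ o := le_trans (by positivity) hole
  -- n15-c∕429
  have key := H mv kk r hk hr hw₀' e he u' hu' U U' hU' (scP d L mv kk hL (aK a₀ (L : ℝ) kk * (((L ^ kk : ℕ) : ℝ)) ^ (d + 1)) ι e U) (covD ((((L ^ kk : ℕ) : ℝ))⁻¹) (fun y => ((cvT e U) ν (((scShift d L mv kk hL) ν).symm y))ᵀ) ⇑((scShift d L mv kk hL) ν).symm) (Matrix.mulVecLin (cGreen (cvM d L mv kk hL) (L ^ kk) (cvT e U) (aK a₀ (L : ℝ) kk * (((L ^ kk : ℕ) : ℝ)) ^ (d + 1)))) (scP' d L mv kk r hL (aK a₀ (L : ℝ) (r + kk) * (((L ^ r * L ^ kk : ℕ) : ℝ)) ^ (d + 1)) ι e U') (covD ((((L ^ r * L ^ kk : ℕ) : ℝ))⁻¹) (fun y => ((cvT e U') ν (((scShift' d L mv kk r hL) ν).symm y))ᵀ) ⇑((scShift' d L mv kk r hL) ν).symm) (Matrix.mulVecLin (cGreen (cvM d L mv kk hL) (L ^ r * L ^ kk) (cvT e U') (aK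 a₀ (L : ℝ) (r + kk) * (((L ^ r * L ^ kk : ℕ) : ℝ)) ^ (d + 1)))) (scNV d L mv kk hL (aK a₀ (L : ℝ) kk * (((L ^ kk : ℕ) : ℝ)) ^ (d + 1)) ι e (fun k x => u' k (kingSec (cvM d L mv kk hL) L kk r x)) U) (scNV' d L mv kk r hL (aK a₀ (L : ℝ) (r + kk) * (((L ^ r * L ^ kk : ℕ) : ℝ)) ^ (d + 1)) ι e u' U') (fun k y => -((fun x => coordMat e (ContinuousLinearMap.mulLeftRight ℝ (Matrix m m ℂ) (u' k (kingSec (cvM d L mv kk hL) L kk r x)) (u' k (kingSec (cvM d L mv kk hL) L kk r x))ᴴ)) y * ((cvT e U) ν (((scShift d L mv kk hL) ν).symm y))ᵀ * ((fun x => coordMat e (ContinuousLinearMap.mulLeftRight ℝ (Matrix m m ℂ) (u' k (kingSec (cvM d L mv kk hL) L kk r x)) (u' k (kingSec (cvM d L mv kk hL) L kk r x))ᴴ)) (((scShift d L mv kk hL) ν).symm y))ᵀ)) (fun k y => (((L ^ kk : ℕ) : ℝ)) • ((fun x => coordMat e (ContinuousLinearMap.mulLeftRight ℝ (Matrix m m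 ℂ) (u' k (kingSec (cvM d L mv kk hL) L kk r x)) (u' k (kingSec (cvM d L mv kk hL) L kk r x))ᴴ)) y * ((cvT e U) ν (((scShift d L mv kk hL) ν).symm y))ᵀ * ((fun x => coordMat e (ContinuousLinearMap.mulLeftRight ℝ (Matrix m m ℂ) (u' k (kingSec (cvM d L mv kk hL) L kk r x)) (u' k (kingSec (cvM d L mv kk hL) L kk r x))ᴴ)) (((scShift d L mv kk hL) ν).symm y))ᵀ - 1)) (fun k y => -((fun x => coordMat e (ContinuousLinearMap.mulLeftRight ℝ (Matrix m m ℂ) (u' k x) (u' k x)ᴴ)) y * ((cvT e U') ν (((scShift' d L mv kk r hL) ν).symm y))ᵀ * ((fun x => coordMat e (ContinuousLinearMap.mulLeftRight ℝ (Matrix m m ℂ) (u' k x) (u' k x)ᴴ)) (((scShift' d L mv kk r hL) ν).symm y))ᵀ)) (fun k y => (((L ^ r * L ^ kk : ℕ) : ℝ)) • ((fun x => coordMat e (ContinuousLinearMap.mulLeftRight ℝ (Matrix m m ℂ) (u' k x) (u' k x)ᴴ)) y * ((cvT e U') ν (((scShift' d L mv kk r hL) ν).symm y))ᵀ * ((fun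 x => coordMat e (ContinuousLinearMap.mulLeftRight ℝ (Matrix m m ℂ) (u' k x) (u' k x)ᴴ)) (((scShift' d L mv kk r hL) ν).symm y))ᵀ - 1)) (fun k x => fgrad ((((L ^ kk : ℕ) : ℝ))⁻¹)⁻¹ ((scShift d L mv kk hL) ν) (scH d L mv kk hL k) x) (fun k x => fgrad ((((L ^ r * L ^ kk : ℕ) : ℝ))⁻¹)⁻¹ ((scShift' d L mv kk r hL) ν) (scH' d L mv kk r hL k) x) ν rV rV (a₀ * (Fintype.card ι * (Fintype.card ι * ((1 + rV * ((((L ^ kk : ℕ) : ℝ))⁻¹)) ^ ((d + 1) * L ^ kk) - 1) ^ 2 + 2 * ((1 + rV * ((((L ^ kk : ℕ) : ℝ))⁻¹)) ^ ((d + 1) * L ^ kk) - 1))) + a₀ * (Fintype.card ι * (Fintype.card ι * ((1 + rV * ((((L ^ r * L ^ kk : ℕ) : ℝ))⁻¹)) ^ ((d + 1) * (L ^ r * L ^ kk)) - 1) ^ 2 + 2 * ((1 + rV * ((((L ^ r * L ^ kk : ℕ) : ℝ))⁻¹)) ^ ((d + 1) * (L ^ r * L ^ kk)) - 1)))) 0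 (1 + rV) rV rV oC oA og oN 0 oR oR' oB (|(((L ^ mv : ℕ) : ℝ))⁻¹| * (((L ^ kk : ℕ) : ℝ) * ((L ^ mv : ℕ) : ℝ))⁻¹ * (64 * π ^ 2 + π ^ 2 * Fintype.card (Fin (d + 1)))) (o + (|(((L ^ mv : ℕ) : ℝ))⁻¹| * (((L ^ kk : ℕ) : ℝ) * ((L ^ mv : ℕ) : ℝ))⁻¹ * (64 * π ^ 2 + π ^ 2 * Fintype.card (Fin (d + 1))))) (Fintype.card ι * (((((L ^ r * L ^ kk : ℕ) : ℝ))⁻¹) * (@basisConst ι _ (Matrix m m ℂ) Matrix.frobeniusNormedAddCommGroup Matrix.frobeniusNormedSpace e * (2 * Real.sqrt (Fintype.card m)) * (Real.sqrt (Fintype.card m) * p))))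
    hrV hrV hRN0 le_rfl (by positivity) hrV hrV hoC hoA hog hoN le_rfl hoR hoR' hoB hO10 hρv0 hRle hrVle hθ₀.le (by linarith) (by linarith) (by linarith) (by linarith)
    (fun k => scP_conj ι e (aK a₀ (L : ℝ) kk * (((L ^ kk : ℕ) : ℝ)) ^ (d + 1)) (fun k x => u' k (kingSec (cvM d L mv kk hL) L kk r x)) U k) hCloc hAloc hDAf hDAb hNVcut hfarN hleib hdh hEcov hRE hRE' hBE
    (fun k => scP'_conj ι e (aK a₀ (L : ℝ) (r + kk) * (((L ^ r * L ^ kk : ℕ) : ℝ)) ^ (d + 1)) u' U' k) hCloc' hAloc' hDAf' hDAb' hNVcut' hfarN' hleib' hdh' hEcovf hREf hREf' hBEf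
    hfitCt hfitAt hfAsh1 hfAsh2 hfgAf hfgAb hDNVc hDfarNa hfRE hfRE' hfBE hfdh hPloc' hρ hY hY'
  refine key.mono fun y y' => mul_le_mul_of_nonneg_right ?_ (Real.exp_nonneg _)
  have hX0 : 0 ≤ εk + ((o + (|(((L ^ mv : ℕ) : ℝ))⁻¹| * (((L ^ kk : ℕ) : ℝ) * ((L ^ mv : ℕ) : ℝ))⁻¹ * (64 * π ^ 2 + π ^ 2 * Fintype.card (Fin (d + 1))))) + ((1 + (Fintype.card ι * (((((L ^ r * L ^ kk : ℕ) : ℝ))⁻¹) * (@basisConst ι _ (Matrix m m ℂ) Matrix.frobeniusNormedAddCommGroup Matrix.frobeniusNormedSpace e * (2 * Real.sqrt (Fintype.card m)) * (Real.sqrt (Fintype.card m) * p))))) ^ ((d + 1) * (L ^ r - 1)) - 1)) := by positivity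
  have hX' : 0 ≤ εk + (o + ((1 + (Fintype.card ι * (((((L ^ r * L ^ kk : ℕ) : ℝ))⁻¹) * (@basisConst ι _ (Matrix m m ℂ) Matrix.frobeniusNormedAddCommGroup Matrix.frobeniusNormedSpace e * (2 * Real.sqrt (Fintype.card m)) * (Real.sqrt (Fintype.card m) * p))))) ^ ((d + 1) * (L ^ r - 1)) - 1)) := by positivity
  calc D * (εk + ((o + (|(((L ^ mv : ℕ) : ℝ))⁻¹| * (((L ^ kk : ℕ) : ℝ) * ((L ^ mv : ℕ) : ℝ))⁻¹ * (64 * π ^ 2 + π ^ 2 * Fintype.card (Fin (d + 1))))) + ((1 + (Fintype.card ι * (((((L ^ r * L ^ kk : ℕ) : ℝ))⁻¹) * (@basisConst ι _ (Matrix m m ℂ) Matrix.frobeniusNormedAddCommGroup Matrix.frobeniusNormedSpace e * (2 * Real.sqrt (Fintype.card m)) * (Real.sqrt (Fintype.card m) * p))))) ^ ((d + 1) * (L ^ r - 1)) - 1))) ≤ |D| * (εk + ((o + (|(((L ^ mv : ℕ) : ℝ))⁻¹| * (((L ^ kk : ℕ) : ℝ) * ((L ^ mv : ℕ) : ℝ))⁻¹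 * (64 * π ^ 2 + π ^ 2 * Fintype.card (Fin (d + 1))))) + ((1 + (Fintype.card ι * (((((L ^ r * L ^ kk : ℕ) : ℝ))⁻¹) * (@basisConst ι _ (Matrix m m ℂ) Matrix.frobeniusNormedAddCommGroup Matrix.frobeniusNormedSpace e * (2 * Real.sqrt (Fintype.card m)) * (Real.sqrt (Fintype.card m) * p))))) ^ ((d + 1) * (L ^ r - 1)) - 1))) := mul_le_mul_of_nonneg_right (le_abs_self D) hX0
    _ ≤ |D| * ((1 + (64 * π ^ 2 + π ^ 2 * Fintype.card (Fin (d + 1)))) * (εk + (o + ((1 + (Fintype.card ι * (((((L ^ r * L ^ kk : ℕ) : ℝ))⁻¹) * (@basisConst ι _ (Matrix m m ℂ) Matrix.frobeniusNormedAddCommGroup Matrix.frobeniusNormedSpace e * (2 * Real.sqrt (Fintype.card m)) * (Real.sqrt (Fintype.card m) * p))))) ^ ((d + 1) * (L ^ r - 1)) - 1)))) := mul_le_mul_of_nonneg_left (by nlinarith [hO1ε, hεk0, ho0, hsS0, hO10, Real.pi_pos]) (abs_nonneg D)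
    _ = |D| * (1 + (64 * π ^ 2 + π ^ 2 * Fintype.card (Fin (d + 1)))) * (εk + (o + ((1 + (Fintype.card ι * (((((L ^ r * L ^ kk : ℕ) : ℝ))⁻¹) * (@basisConst ι _ (Matrix m m ℂ) Matrix.frobeniusNormedAddCommGroup Matrix.frobeniusNormedSpace e * (2 * Real.sqrt (Fintype.card m)) * (Real.sqrt (Fintype.card m) * p))))) ^ ((d + 1) * (L ^ r - 1)) - 1))) := by ring

end Green

end Summit.QuantumFields.YangMills.BalabanUVNodes.N15.Gluing

end
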